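import Literature.MathematicalPhysics.QuantumFieldTheory.Balaban1983to89.B2Ineq329PrismHolonomy
import Literature.MathematicalPhysics.QuantumFieldTheory.Balaban1983to89.HiggsCovarianceCont
import Literature.MathematicalPhysics.QuantumFieldTheory.Balaban1983to89.B1RG242Torus
import Literature.MathematicalPhysics.QuantumFieldTheory.BalabanImbrieJaffe1984to88.BIJ88NeumannPropagator227Torus

/-!
# `BalabanImbrieJaffe1984to88.BIJ85CovariantHiggsDictionary` — T. Bałaban, J. Imbrie, A. Jaffe, *Renormalization of the Higgs model: minimizers,
# propagators and the stability of mean field theory*, Commun. Math. Phys. **97** (1985) 299–329 [BalabanImbrieJaffe1985], §7.3 p. 326 [PDF 28]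
# «by change of gauge u_k can be transformed in a local region Λ into a configuration of the form exp[ie_kηA]», with [B1] = T. Bałaban,
# *(Higgs)₂,₃ quantum fields in a finite volume. I*, Commun. Math. Phys. **85** (1982) 603–626 [Balaban1982Higgs1] (1.5), (1.7), (2.1)–(2.3),
# (2.11), (2.17), (2.20) and [7] = T. Bałaban, *Regularity and decay of lattice Green's functions*, Commun. Math. Phys. **89** (1983) 571–597
# [Balaban1983RegularityDecay] (1.2)–(1.6): **THE NON-ZERO-FIELD DICTIONARY — AT `u = e^{ieεA}` THE C1/C2 COVARIANT OBJECTS ON THE `Setup`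
# TORI (p11's `u(Γ^{(k)}_{x_k,x})`/`Q_k(u)`, p31's `(χ_ΩD_u)ᴴ(χ_ΩD_u)`, `nOp`, `G_k(Ω,u) = gBox`) ARE THE (Higgs)₂,₃ COVARIANT OBJECTS OF THE
# typer/p35 LINEAGE ON THE `HiggsLattice` TORI (`A(Γ^{(k)}_{y,x})`, `Q_k(A)`, `−Δ^{ε,N}_{A,Ω}`, `−Δ^{ε,N}_{A,Ω} + m² + a_k(L^kε)^{−2}P_k(A)`,
# `G^ε_k(Ω,A)`) FOR THE ROTATION CHARGE `N = 2`, REALIFIED.**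

statement-level skeleton of published theorems with citation tags; proofs where landed; nothing here is a claim about the Yang–Mills mass gap

PDFs held: `paper:balaban1985-cmp97-bij-higgs-minimizers` (journal page = PDF page + 298; p. 326 [PDF 28], pp. 302–303 [PDF 4–5], p. 313
[PDF 15]); `paper:balaban1982-cmp85-higgs23-i` (journal page = PDF page + 602; pp. 604–610 [PDF 2–8]); `paper:balaban1983-cmp89-regularity-decay`
(journal page = PDF page + 570; pp. 572–573 [PDF 2–3]).

CITATION HEADER (lean-in-tree rule).  Cell `lit-balaban` (HOME `run/shared/lean/pub/lit-balaban/`), Phase 2, reader seat **r01 gen 25** (unit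
`lit-balaban-r01`, literature-prover-lit-balaban-r01-g25-0; B4 fold owner), free-target protocol G.5-34(d), TAKING line HOME/STATUS.md
2026-08-22T22:31:42Z.  Rows served (cells only, no head change): **B4.Thm@573** (owner r01; the C2-carrier instance of [7]'s Theorem p. 573 at
`A ≠ 0` = the route to it: with this dictionary p35/r14's [B1] Props. 2.1–2.3 at (2.23)-regular `A` apply BY NAME to the C2 Neumann propagators
`G_k(Ω,u)` at non-flat `u = e^{ieεA}`), **C1.Eq7.3.1-7.3.2** (owner r15; HOME/GAPS.md G-C1-05 ADDENDUM 12 HONEST SCOPE (i): «NOT addressed: the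
relation of this family to [BIJ85]'s … G_k(u_k) … the tree's … contour conventions versus r01's corner-based staircases»), **C2.Eq2.27/2.30/2.31**
(owner r18; p31 g19 / p27 g32 HONEST SCOPE «no Neumann sub-domains G_k(□,u) at non-flat fields»); p11's `BIJ85BlockAveragesTorusK` header «The
B1-carrier version of the same objects (`HiggsAveraging.avgQk`, …) lives on the `HiggsLattice` tori with Lie-algebra transports U(A(Γ)); no bridge
is built here (different `Params`)» — THIS FILE IS THAT BRIDGE.  USED BY NAME, never restated: typer's `HiggsLattice` / `HiggsAveraging` /
`HiggsCovariance` ((1.2)–(2.22) objects), r14/p35's `HiggsCovarianceCont.fwdTerm_apply`/`bwdTerm_apply`, `HiggsCovariancePos.propagatorK_covOpK_apply`,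
p15's `B2Ineq329ZeroAveraging.val_blockIter` / `B2Ineq329PrismHolonomy.val_toFinest`/`val_steps`, `B2Restr216Lattice.val_blockOf`; pv07's `Setup` /
`TorusGeometry` / `B1RG242Torus.α`; r18's `BIJ85BlockAveragesTorus` (`corner`, `legSite`, `legBond`, `legProd`, `holC`, `runSite`, `runBond`, `runC`,
`expU1`, `corner_shift`), p11's `BIJ85BlockAveragesTorusK` (`lineU`, `lineIter`, `blkIter`, `cornerIter`, `blockK`, `holCK`, `qCovK`, `qCovK_apply`),
p31's `BIJ88NeumannPropagator227Torus` (`qMatK`, `dN`, `nOp`, `nPad`, `gBox`, `isUnit_nPad`, `nOp_mul_gBox`) and `BIJ88NeumannNoZeroModesTorus.IsBlockUnion`,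
r18's `BIJ88Sect3Statements` (`U1`, `toC`, `cfg`, `covD`, `starB`), r16's `BIJ88Vj5610Operator.dMat`.

WHAT IS PRINTED (verbatim).  [BIJ85] p. 326: *«The propagators arising from Δ_k(u_k), under the restriction (7.3.1) on the gauge field, also satisfy
the regularity and decay estimates of [7]. In order to remain within the framework of this reference, we remark that by change of gauge u_k can be
transformed in a local region Λ into a configuration of the form exp[ie_kηA], where A is smooth and small.»*  [B1] p. 605: *«U(A) = exp(qεeA), A ∈ R,
where e is a coupling constant and q is an antisymmetric N × N matrix. We will assume only that ‖q‖ ≦ 1.»*; p. 608: *«Γ_{y,x} = ⟨y, (y₁,…,y_{d−1},x_d)⟩ ∪ …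
∪ ⟨(y₁,x₂,…,x_d), x⟩ (2.1) … Γ^{(k)}_{y,x} = Γ_{y,x_{k−1}} ∪ Γ_{x_{k−1},x_{k−2}} ∪ … ∪ Γ_{x₁,x} (2.2) … A(Γ) = Σ_{b⊂Γ} A_b (2.3)»*; p. 609: *«(Q_k(A)f)(y) =
L^{−kd}Σ_{x∈B^k(y)} U(A(Γ^{(k)}_{y,x}))f(x) (2.11)»*; p. 610: *«G^ε_k(Ω,A) = (−Δ^{ε,N}_{A,Ω} + m² + a_k(L^kε)^{−2}P_k(A))^{−1}, P_k(A) = Q^*_k(A)Q_k(A) (2.20)»*.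
[BIJ85] p. 302–303: *«define u(Γ) = Π_{b∈Γ} u_b. (2.5) … (Qφ)_y = L^{−d}Σ_{x∈B(y)} u(Γ_{yx})φ_x (2.6)»*; p. 313: *«G_k(u_k) = [−Δ_{u_k} + a_kQ_k^*(u_k)Q_k(u_k)]^{−1}
(4.6.2) … The contour Γ_{x_k,x} runs from x to x₁ in B(x₁), from x₁ to x₂ in B(x₂), etc.»* (5.1.3).  [BIJ88] (2.27) p. 263: `G_k(□_α, u)` with Neumann
boundary conditions (p31's `gBox`).

WHAT THIS FILE DEFINES (definitions with bodies; no `def … : Prop`, no named fact) AND PROVES (kernel-checked; 0 `sorry`; axioms standard).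
* §1 `toE : ℂ ≃ₗᵢ[ℝ] ℝ²`, `mulE`/`mulEHom` (multiplication by `w` read on `ℝ²`, a continuous ring homomorphism), `rotGen = Φ(i)`, **`rotCharge e :
  ChargeData 2`** (`q = J`, `J* = −J`, `‖J‖ ≦ 1` — the abelian-Higgs instance of [B1] (1.7)); `exp_mulE` (`exp ∘ Φ = Φ ∘ exp`, Mathlib `NormedSpace.map_exp`),
  **`rotCharge_U_toE`: `U(A)(toE z) = toE(e^{iηeA}z)`**.
* §2 **`higgsOf P r : HiggsLattice.Params`** — the (Higgs)₂,₃ parameters of a `Setup` torus (`ε = L^{−K}`, `K_H = m + K − r`, big blocks `M = L^r`, `L′_μ = 1`;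
  `higgsOf_sitesPerDir`: the same `2L^{m+K−j}` sites per direction at every level `j + r ≦ m + K`; `higgsOf_mesh`: `L^kε` = `spacing k`), **`eSite`** — the
  label-preserving site identification `T^{(j)}_{L^jε} ≃ T^{(j)}` (`val_eSite`) with `eSite_shift/unshift/shiftN/blockOf/blockIter/toFinest`
  ([B1] (1.17)/(1.20)/(2.2) ↔ p11's `blockOf`/`blkIter`/`cornerIter`), `sum_blockK_eq`.
* §3 **`expGauge P e A : GaugeField P 0 U1`**, `u_b = e^{ieεA_b}` (`toC_expGauge`); `vecH` (the bond function read as [B1]'s vector field); the `Setup`-side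
  structure theorems `toC_lineIter` (p11's iterated block field `u^{(i)}` on a coarse bond = the ordered product over the `L^i` fine bonds of the straight
  run from the iterated corner), `holC_lineIter`, `holCK_eq_prod`, **`holCK_eq_prod_bonds`** (the composite transport (5.1.3) as a product of fine bond
  variables), the Higgs-side `multiContourSum_vecH` ([B1]'s `A(Γ^{(k)}_{y,x})` = the sum over the SAME bonds: `eSite_corner_leg` — the two staircase
  conventions agree, corner-based and highest axis first — and `val_steps_eq_inBlock`), and the HOLONOMY DICTIONARY **`holCK_expGauge`:
  `u(Γ^{(k)}_{x_k,x}) = exp(ieε·A_H(Γ^{(k)}_{x_k,x}))`**, with `U_multiContourSum_toE` ([B1]'s transport `U(A(Γ^{(k)}))` acts on `ℝ² ≅ ℂ` as multiplication by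
  p11's `holCK`), `U_bond_toE`, `star_U_bond_toE`.
* §4 `rfield`/`rfieldK` (realified fields), `regH` (`Ω` read on the Higgs torus); **`avgQkLin_rfield`** ([B1] (2.11) `Q_k(A_H)φ_ℝ = (Q_k(u)φ)_ℝ`),
  **`avgQkAdj_rfieldK`** (the (1.5)-adjoint `Q_k^*` = `ū(Γ^{(k)})·ψ(x_k)`, no weight), `conjTranspose_qMatK_mulVec` (p31's matrix adjoint carries `L^{−kd}`),
  `gram_dN_mulVec_apply_region` (p27's entrywise covariant Laplacian with the Neumann cut-off of a region), **`covLaplacianN_rfield`** ([B1] (2.17)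
  `−Δ^{ε,N}_{A_H,Ω_H}` = p31's `(χ_ΩD_u)ᴴ(χ_ΩD_u)` at `c = ε⁻¹`), **`projPk_rfield`** (`a_k(L^kε)^{−2}P_k(A_H)` = `α_kL^{kd}(Q_k|_Ω)ᴴ(Q_k|_Ω)` on fields supported in a
  `k`-block union), and THE OPERATOR DICTIONARY **`covOpK_rfield`: `(−Δ^{ε,N}_{A_H,Ω_H} + m² + a_k(L^kε)^{−2}P_k(A_H))φ_ℝ = ((nOp (α_kL^{kd}) ε⁻¹ u k Ω) φ + m²φ)_ℝ`**
  for `Ω` a `k`-block union and `φ` supported in `Ω`.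
* §5 `cfield` (inverse realification), **`covOpK_rfield_gBox`** — p31's massless Neumann propagator `G_k(Ω,u)f` SOLVES [B1]'s (2.20) at `m² = 0` for every
  source supported in `Ω` ([7]'s `G_k(Ω,A)` of (1.6), `m² = 0`, `N = 2`, IS [BIJ88]'s `G_k(Ω,u)`), and **`propagatorK_rfield_eq`** — at `m² > 0` any `Ω`-supported
  solution of p31's `(nOp + m²)ψ = f` realifies to typer/p35's `propagatorK … f_ℝ` (uniqueness transfer).

HONEST SCOPE.  (i) A DICTIONARY: definitions with bodies and identities; no estimate of [7]/[B1] is applied here — the decay/regularity members for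
`G_k(Ω,u)` at regular non-flat `u` (p35's `B1Ineq225RegularRegion`, `B1Ineq225DerivRegularRegion`, `B1Ineq226*` through §4–§5 plus the `ε`-scaling and
`m² ↓ 0` limit that [B1]'s `m² > 0` requires) are the announced file 2.  (ii) `N = 2` (the abelian Higgs model: `U(1) ≅ SO(2)`); the field is «of the form
exp[ie_kηA]» GLOBALLY on the torus — which `u` admit such an `A` (locally always, p33's `BIJ85LocalSmoothGauge326`/`BIJ85SmoothGaugeRegular17`; globally up
to the flux sectors, p33's `BIJ85GlobalGaugeObstruction326`) is not this file's business; gauge covariance of `gBox` (p31) moves the estimates between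
gauges.  (iii) Levels: `Setup` level `0` (the `ε`-lattice, `ε = L^{−K}`) with averaging depth `k`, `k + r ≦ m + K` (standing ranges of both tori); p31's
objects are taken at `c = ε⁻¹` and `a = α_kL^{kd}` (the arguments of record of the C2 lane, `α_k = a_k(L^kε)^{−2}` = pv07's `α P a k`).  (iv) The B4-lineage
region operators of b04/r01 (`regionOp`, single lowest-axis-first staircase `rstairContour` from `n·y`) are NOT p11's composite highest-axis-first contours
for `k ≧ 2` and are not touched here (that divergence is why the route goes through the B1 lineage; cf. G-C1-05 ADD. 12 scope (i)).  (v) Nothing printed is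
contradicted; no statement weakened; no head changes.  Imports: Literature + Mathlib only.  Unit `lit-balaban-r01` (literature-prover-lit-balaban-r01-g25-0),
2026-08-22.  NOT summit progress.
-/

namespace Literature.MathematicalPhysics.QuantumFieldTheory.BalabanImbrieJaffe1984to88.BIJ85CovariantHiggsDictionary

open Literature.MathematicalPhysics.QuantumFieldTheory.Balaban1983to89
open HiggsAveraging (toFinest blockIter shiftN segSum contourSum multiContourSum)
open BIJ88Sect3Statements (U1 toC toC_mul toC_one norm_toC cfg covD)
open BIJ85BlockAveragesTorus (runSite runBond runC legSite legBond legProd holC expU1 toC_expU1 val_corner corner_shift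
  runSite_shift runSite_zero runBond_tgt legBond_tgt legSite_shift toC_ne_zero)
open BIJ85BlockAveragesTorusK (blkIter cornerIter lineIter lineU holCK qCovK blkIter_zero blkIter_succ cornerIter_zero
  cornerIter_succ lineIter_zero lineIter_succ holCK_zero holCK_succ toC_lineU toC_runProd qCovK_apply)
open BIJ88NeumannPropagator227Torus (qMatK dN nOp nPad gBox proj cproj blocksIn qMatK_apply qMatK_mulVec dN_apply dN_mulVec
  nOp_eq proj_mulVec)
open scoped BigOperators ComplexConjugate Matrix
open Finset Matrix

noncomputable section

/-- `ℝ² = EuclideanSpace ℝ (Fin 2)`, the value space of the `N = 2` (Higgs)₂,₃ scalar field. [cite: Balaban1982Higgs1, (1.5) p.604 «φ : T_ε → R^N», dictionary: N = 2, R² ≅ ℂ] -/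
abbrev E2 : Type := EuclideanSpace ℝ (Fin 2)

/-- THE REALIFICATION `ℂ ≃ ℝ²` (real-linear isometry; coordinates `(re, im)` in the basis `1, i`). [cite: Balaban1982Higgs1, (1.5) p.604 «φ : T_ε → R^N», dictionary: N = 2, R² ≅ ℂ] -/
def toE : ℂ ≃ₗᵢ[ℝ] E2 := Complex.orthonormalBasisOneI.repr

/-- kernel: the coordinates of the realification. [cite: Balaban1982Higgs1, (1.5) p.604 «φ : T_ε → R^N», dictionary: N = 2, R² ≅ ℂ] -/
theorem toE_apply (z : ℂ) (i : Fin 2) : toE z i = ![z.re, z.im] i := by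
  rw [toE]
  have h := Complex.orthonormalBasisOneI_repr_apply z
  exact congrFun h i

/-- `toE` as a continuous real-linear equivalence. [cite: Balaban1982Higgs1, (1.5) p.604 «φ : T_ε → R^N», dictionary: N = 2, R² ≅ ℂ] -/
def toEL : ℂ ≃L[ℝ] E2 := toE.toContinuousLinearEquiv

/-- kernel: unfolding. [cite: Balaban1982Higgs1, (1.5) p.604 «φ : T_ε → R^N», dictionary: N = 2, R² ≅ ℂ] -/
@[simp] theorem toEL_apply (z : ℂ) : toEL z = toE z := rfl
/-- kernel: unfolding. [cite: Balaban1982Higgs1, (1.5) p.604 «φ : T_ε → R^N», dictionary: N = 2, R² ≅ ℂ] -/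
@[simp] theorem toEL_symm_apply (v : E2) : toEL.symm v = toE.symm v := rfl

/-- multiplication by `w ∈ ℂ` read on `ℝ²`: `Φ(w) = toE ∘ (w·) ∘ toE⁻¹`, a continuous real-linear map. [cite: Balaban1982Higgs1, (1.7) p.605 «U(A) = exp(qεeA) … q is an antisymmetric N × N matrix», dictionary: N = 2] -/
def mulE (w : ℂ) : E2 →L[ℝ] E2 :=
  (toEL : ℂ →L[ℝ] E2).comp (((ContinuousLinearMap.mul ℝ ℂ) w).comp (toEL.symm : E2 →L[ℝ] ℂ))

/-- kernel: unfolding. [cite: Balaban1982Higgs1, (1.7) p.605 «U(A) = exp(qεeA) … q is an antisymmetric N × N matrix», dictionary: N = 2] -/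
theorem mulE_apply (w : ℂ) (v : E2) : mulE w v = toE (w * toE.symm v) := rfl

/-- kernel: `Φ(w)(toE z) = toE(wz)`. [cite: Balaban1982Higgs1, (1.7) p.605 «U(A) = exp(qεeA) … q is an antisymmetric N × N matrix», dictionary: N = 2] -/
theorem mulE_toE (w z : ℂ) : mulE w (toE z) = toE (w * z) := by
  rw [mulE_apply, LinearIsometryEquiv.symm_apply_apply]

/-- `Φ : ℂ →+* (ℝ² →L[ℝ] ℝ²)`, `w ↦ mulE w`, a ring homomorphism. [cite: Balaban1982Higgs1, (1.7) p.605 «U(A) = exp(qεeA) … q is an antisymmetric N × N matrix», dictionary: N = 2] -/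
def mulEHom : ℂ →+* (E2 →L[ℝ] E2) where
  toFun := mulE
  map_one' := by ext v i; simp [mulE_apply]
  map_mul' w w' := by
    ext v i
    rw [show (mulE w * mulE w') v = mulE w (mulE w' v) from rfl]
    simp only [mulE_apply, LinearIsometryEquiv.symm_apply_apply, mul_assoc]
  map_zero' := by ext v i; simp [mulE_apply]
  map_add' w w' := by
    ext v i
    rw [show (mulE w + mulE w') v = mulE w v + mulE w' v from rfl]
    simp only [mulE_apply, add_mul, map_add, PiLp.add_apply]

/-- kernel: unfolding. [cite: Balaban1982Higgs1, (1.7) p.605 «U(A) = exp(qεeA) … q is an antisymmetric N × N matrix», dictionary: N = 2] -/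
theorem mulEHom_apply (w : ℂ) : mulEHom w = mulE w := rfl

/-- `Φ` as a real-linear map (for continuity). [cite: Balaban1982Higgs1, (1.7) p.605 «U(A) = exp(qεeA) … q is an antisymmetric N × N matrix», dictionary: N = 2] -/
def mulELin : ℂ →ₗ[ℝ] (E2 →L[ℝ] E2) where
  toFun := mulE
  map_add' w w' := mulEHom.map_add w w'
  map_smul' r w := by
    ext v i
    show (mulE (r • w) v) i = ((r • mulE w) v) i
    rw [show (r • mulE w) v = r • mulE w v from rfl]
    simp only [mulE_apply, smul_mul_assoc, LinearIsometryEquiv.map_smul]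

/-- kernel: `Φ` is continuous (finite dimension). [cite: Balaban1982Higgs1, (1.7) p.605 «U(A) = exp(qεeA) … q is an antisymmetric N × N matrix», dictionary: N = 2] -/
theorem continuous_mulEHom : Continuous (mulEHom : ℂ → (E2 →L[ℝ] E2)) := by
  have h : (mulEHom : ℂ → (E2 →L[ℝ] E2)) = mulELin := rfl
  rw [h]
  exact LinearMap.continuous_of_finiteDimensional mulELin

/-- the rotation generator `J = Φ(i)` on `ℝ²` (`J² = −1`), the `N = 2` charge matrix `q`. [cite: Balaban1982Higgs1, (1.7) p.605 «U(A) = exp(qεeA) … q is an antisymmetric N × N matrix», dictionary: N = 2] -/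
def rotGen : E2 →L[ℝ] E2 := mulE Complex.I

/-- kernel: the real inner product of `ℝ²` read on `ℂ`: `⟨z, w⟩ = Re(z̄w)`. [cite: Balaban1982Higgs1, (1.5) p.604 «φ : T_ε → R^N», dictionary: N = 2, R² ≅ ℂ] -/
theorem inner_toE (z w : ℂ) : @inner ℝ E2 _ (toE z) (toE w) = (conj z * w).re := by
  rw [toE.inner_map_map, Complex.inner, mul_comm]

/-- kernel: the adjoint of `Φ(w)` is `Φ(w̄)`. [cite: Balaban1982Higgs1, (1.7) p.605 «U(A) = exp(qεeA) … q is an antisymmetric N × N matrix», dictionary: N = 2] -/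
theorem star_mulE (w : ℂ) : star (mulE w) = mulE (conj w) := by
  rw [ContinuousLinearMap.star_eq_adjoint]
  refine (ContinuousLinearMap.eq_adjoint_iff (mulE (conj w)) (mulE w)).2 ?_ |>.symm
  intro v v'
  obtain ⟨z, rfl⟩ := toE.surjective v
  obtain ⟨z', rfl⟩ := toE.surjective v'
  rw [mulE_toE, mulE_toE, inner_toE, inner_toE]
  simp only [map_mul, Complex.conj_conj]
  ring_nf

/-- kernel: **`J` is antisymmetric**, `J* = −J` — «q is an antisymmetric N × N matrix». [cite: Balaban1982Higgs1, (1.7) p.605 «U(A) = exp(qεeA) … q is an antisymmetric N × N matrix», dictionary: N = 2] -/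
theorem star_rotGen : star rotGen = -rotGen := by
  rw [rotGen, star_mulE, Complex.conj_I]
  ext v i
  simp [mulE_apply]

/-- kernel: `‖Φ(w)‖ ≦ |w|`. [cite: Balaban1982Higgs1, (1.7) p.605 «U(A) = exp(qεeA) … q is an antisymmetric N × N matrix», dictionary: N = 2] -/
theorem norm_mulE_le (w : ℂ) : ‖mulE w‖ ≤ ‖w‖ := by
  refine ContinuousLinearMap.opNorm_le_bound _ (norm_nonneg _) fun v => ?_
  obtain ⟨z, rfl⟩ := toE.surjective v
  rw [mulE_toE, LinearIsometryEquiv.norm_map, LinearIsometryEquiv.norm_map, norm_mul]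

/-- kernel: **`‖J‖ ≦ 1`** — «We will assume only that ‖q‖ ≦ 1». [cite: Balaban1982Higgs1, (1.7) p.605 «U(A) = exp(qεeA) … q is an antisymmetric N × N matrix», dictionary: N = 2] -/
theorem norm_rotGen_le : ‖rotGen‖ ≤ 1 := (norm_mulE_le _).trans (by rw [Complex.norm_I])

/-- **THE ROTATION CHARGE** `(e, q = J)`: the `N = 2` instance of [B1] (1.7) p.605 «U(A) = exp(qεeA)» realising the `U(1)` Higgs model
(`e^{qθ}` = rotation by `θ` = multiplication by `e^{iθ}` on `ℂ ≅ ℝ²`; the abelian Higgs model of [BIJ85] §1). [cite: Balaban1982Higgs1, (1.7) p.605 «U(A) = exp(qεeA) … q is an antisymmetric N × N matrix», dictionary: N = 2] -/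
def rotCharge (e : ℝ) : HiggsLattice.ChargeData 2 where
  e := e
  q := rotGen
  q_skew := star_rotGen
  norm_q_le := norm_rotGen_le

/-- kernel: `Φ` commutes with the exponential, `exp(Φ(w)) = Φ(e^w)` (a continuous ring homomorphism; Mathlib `NormedSpace.map_exp`). [cite: Balaban1982Higgs1, (1.7) p.605 «U(A) = exp(qεeA) … q is an antisymmetric N × N matrix», dictionary: N = 2] -/
theorem exp_mulE (w : ℂ) : NormedSpace.exp (mulE w) = mulE (Complex.exp w) := by
  letI : NormedAlgebra ℚ ℂ := NormedAlgebra.restrictScalars ℚ ℝ ℂ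
  letI : NormedAlgebra ℚ (E2 →L[ℝ] E2) := NormedAlgebra.restrictScalars ℚ ℝ _
  have h := NormedSpace.map_exp mulEHom continuous_mulEHom w
  rw [mulEHom_apply, mulEHom_apply, Complex.exp_eq_exp_ℂ] at *
  exact h.symm

/-- **`U(A) = e^{qηeA}` IS MULTIPLICATION BY `e^{iηeA}`** read on `ℝ²`. [cite: Balaban1982Higgs1, (1.7) p.605 «U(A) = exp(qεeA) … q is an antisymmetric N × N matrix», dictionary: N = 2] -/
theorem rotCharge_U (e η A : ℝ) : (rotCharge e).U η A = mulE (Complex.exp ((η * e * A : ℝ) * Complex.I)) := by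
  show NormedSpace.exp ((η * e * A) • rotGen) = _
  have h : (η * e * A) • mulE Complex.I = mulE ((η * e * A : ℝ) * Complex.I) := by
    have h1 := mulELin.map_smul (η * e * A) Complex.I
    rw [Complex.real_smul] at h1
    exact h1.symm
  rw [rotGen, h]
  exact exp_mulE _

/-- **`U(A)(toE z) = toE(e^{iηeA}z)`**. [cite: Balaban1982Higgs1, (1.7) p.605 «U(A) = exp(qεeA) … q is an antisymmetric N × N matrix», dictionary: N = 2] -/
theorem rotCharge_U_toE (e η A : ℝ) (z : ℂ) :
    (rotCharge e).U η A (toE z) = toE (Complex.exp ((η * e * A : ℝ) * Complex.I) * z) := by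
  rw [rotCharge_U, mulE_toE]

/-- kernel: the coupling constant of the rotation charge. [cite: Balaban1982Higgs1, (1.7) p.605 «U(A) = exp(qεeA) … q is an antisymmetric N × N matrix», dictionary: N = 2] -/
theorem rotCharge_e (e : ℝ) : (rotCharge e).e = e := rfl


/-! ## §2 The (Higgs)₂,₃ parameters of a `Setup` torus and the site identification -/

section HiggsOf

variable (P : Params)

/-- **THE (Higgs)₂,₃ PARAMETERS OF A `Setup` TORUS** `T^{(0)} = (ℤ/2L^{m+K})^d`, `ε = L^{−K}`: the `HiggsLattice` torus with the same
fine spacing `ε`, top level `K_H = m + K − r`, big-block size `M = L^r` and `L′_μ = 1` — so that `2L^{K_H−j}ML′_μ = 2L^{m+K−j}` at every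
level `j ≦ K_H` (`higgsOf_sitesPerDir`): [B1] (1.2) p.604 «ε^{−1}L_μ = L^KML′_μ» read for [BIJ85]'s torus «T_ε … L_μ = L^m» (the free
exponent `r` places the big blocks of [B1] Props 2.1–2.3 at size `L^r`). [cite: Balaban1982Higgs1, (1.2) p.604, dictionary] -/
@[reducible] def higgsOf (r : ℕ) : HiggsLattice.Params where
  d := P.d
  ε := P.eps
  K := P.m + P.K - r
  L := P.L
  M := P.L ^ r
  Lp := fun _ => 1
  hd := P.hd
  hε := P.eps_pos
  hL := P.L_pos
  hM := pow_pos P.L_pos r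
  hLp := fun _ => Nat.one_pos

variable {P} {r : ℕ}

/-- kernel: same dimension. [cite: Balaban1982Higgs1, (1.2) p.604, dictionary] -/
@[simp] theorem higgsOf_d : (higgsOf P r).d = P.d := rfl
/-- kernel: same `L`. [cite: Balaban1982Higgs1, (1.2) p.604, dictionary] -/
@[simp] theorem higgsOf_L : (higgsOf P r).L = P.L := rfl
/-- kernel: same fine spacing `ε = L^{−K}`. [cite: Balaban1982Higgs1, (1.2) p.604, dictionary] -/
@[simp] theorem higgsOf_ε : (higgsOf P r).ε = P.eps := rfl
/-- kernel: top level `K_H = m + K − r`. [cite: Balaban1982Higgs1, (1.2) p.604, dictionary] -/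
theorem higgsOf_K : (higgsOf P r).K = P.m + P.K - r := rfl
/-- kernel: big blocks of size `M = L^r`. [cite: Balaban1982Higgs1, (1.2) p.604, dictionary] -/
theorem higgsOf_M : (higgsOf P r).M = P.L ^ r := rfl

/-- kernel: **the meshes agree** — `L^kε` ([B1] (1.19)) is `Setup`'s `spacing k`. [cite: Balaban1982Higgs1, (1.19) p.607, dictionary] -/
theorem higgsOf_mesh (k : ℕ) : (higgsOf P r).mesh k = P.spacing k := rfl

/-- kernel: **the site counts agree at every level `j` with `j + r ≦ m + K`**: `2L^{K_H−j}·L^r·1 = 2L^{m+K−j}`.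
[cite: Balaban1982Higgs1, (1.2) p.604, dictionary] -/
theorem higgsOf_sitesPerDir {j : ℕ} (hjr : j + r ≤ P.m + P.K) (μ : Fin P.d) :
    (higgsOf P r).sitesPerDir j μ = P.sitesPerDir j := by
  show 2 * (P.L ^ (P.m + P.K - r - j) * P.L ^ r * 1) = 2 * P.L ^ (P.m + P.K - j)
  rw [mul_one, ← pow_add]
  have h : P.m + P.K - r - j + r = P.m + P.K - j := by omega
  rw [h]

/-- kernel: the site counts of level `j` of the Higgs torus and level `j'` of the `Setup` torus agree when `j = j'` and `j + r ≦ m + K`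
(the level is carried twice to absorb `0 + k` versus `k`). [cite: Balaban1982Higgs1, (1.2) p.604, dictionary] -/
theorem sites_eq {j j' : ℕ} (hjj : j = j') (hjr : j + r ≤ P.m + P.K) (μ : Fin P.d) :
    (higgsOf P r).sitesPerDir j μ = P.sitesPerDir j' := by
  subst hjj; exact higgsOf_sitesPerDir hjr μ

variable (P r)

/-- **THE SITE IDENTIFICATION `T^{(j)}_{L^jε} ≃ T^{(j)}`** between the (Higgs)₂,₃ torus `higgsOf P r` and the `Setup` torus `P`
(coordinatewise `ZMod.ringEquivCongr`; integer labels preserved, `val_eSite`). [cite: Balaban1982Higgs1, (1.2) p.604, dictionary] -/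
def eSite {j j' : ℕ} (hjj : j = j') (hjr : j + r ≤ P.m + P.K) : HiggsLattice.Site (higgsOf P r) j ≃ Balaban1983to89.Site P j' where
  toFun x := fun μ => ZMod.ringEquivCongr (sites_eq hjj hjr μ) (x μ)
  invFun z := fun μ => (ZMod.ringEquivCongr (sites_eq hjj hjr μ)).symm (z μ)
  left_inv x := funext fun μ => (ZMod.ringEquivCongr (sites_eq hjj hjr μ)).symm_apply_apply (x μ)
  right_inv z := funext fun μ => (ZMod.ringEquivCongr (sites_eq hjj hjr μ)).apply_symm_apply (z μ)

variable {P r}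

section ESite

variable {j j' : ℕ} (hjj : j = j') (hjr : j + r ≤ P.m + P.K)

/-- kernel: unfolding. [cite: Balaban1982Higgs1, (1.2) p.604, dictionary] -/
theorem eSite_apply (x : HiggsLattice.Site (higgsOf P r) j) (μ : Fin P.d) :
    eSite P r hjj hjr x μ = ZMod.ringEquivCongr (sites_eq hjj hjr μ) (x μ) := rfl

/-- kernel: **labels are preserved**. [cite: Balaban1982Higgs1, (1.2) p.604, dictionary] -/
theorem val_eSite (x : HiggsLattice.Site (higgsOf P r) j) (μ : Fin P.d) : ((eSite P r hjj hjr x) μ).val = (x μ).val := by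
  rw [eSite_apply]; exact ZMod.ringEquivCongr_val _ _

/-- kernel: labels are preserved by the inverse identification. [cite: Balaban1982Higgs1, (1.2) p.604, dictionary] -/
theorem val_eSite_symm (z : Balaban1983to89.Site P j') (μ : Fin P.d) : (((eSite P r hjj hjr).symm z) μ).val = (z μ).val := by
  conv_rhs => rw [← (eSite P r hjj hjr).apply_symm_apply z]
  rw [val_eSite]

/-- kernel: two `Setup` sites with the same labels are equal. [folklore] -/
private theorem site_eq_of_val_eq {i : ℕ} {z w : Balaban1983to89.Site P i} (h : ∀ μ, (z μ).val = (w μ).val) : z = w :=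
  funext fun μ => ZMod.val_injective _ (h μ)

/-- kernel: two Higgs sites with the same labels are equal. [folklore] -/
private theorem hsite_eq_of_val_eq {i : ℕ} {z w : HiggsLattice.Site (higgsOf P r) i} (h : ∀ μ : Fin P.d, (z μ).val = (w μ).val) : z = w :=
  funext fun μ => ZMod.val_injective _ (h μ)

/-- kernel: forward steps correspond, `e(x + e_μ) = e(x) + e_μ`. [cite: Balaban1982Higgs1, (1.2) p.604, dictionary] -/
theorem eSite_shift (x : HiggsLattice.Site (higgsOf P r) j) (μ : Fin P.d) :
    eSite P r hjj hjr (x.shift μ) = (eSite P r hjj hjr x).shift μ := by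
  funext ν
  by_cases h : ν = μ
  · subst h
    simp only [eSite_apply, HiggsLattice.Site.shift, Balaban1983to89.Site.shift, Function.update_self, map_add, map_one]
  · have hx : Function.update x μ (x μ + 1) ν = x ν := Function.update_of_ne h _ _
    simp only [eSite_apply, HiggsLattice.Site.shift, Balaban1983to89.Site.shift, hx, Function.update_of_ne h]

/-- kernel: backward steps correspond. [cite: Balaban1982Higgs1, (1.2) p.604, dictionary] -/
theorem eSite_unshift (x : HiggsLattice.Site (higgsOf P r) j) (μ : Fin P.d) :
    eSite P r hjj hjr (x.unshift μ) = (eSite P r hjj hjr x).unshift μ := by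
  funext ν
  by_cases h : ν = μ
  · subst h
    simp only [eSite_apply, HiggsLattice.Site.unshift, Balaban1983to89.Site.unshift, Function.update_self, map_sub, map_one]
  · have hx : Function.update x μ (x μ - 1) ν = x ν := Function.update_of_ne h _ _
    simp only [eSite_apply, HiggsLattice.Site.unshift, Balaban1983to89.Site.unshift, hx, Function.update_of_ne h]

/-- kernel: forward steps under the inverse identification. [cite: Balaban1982Higgs1, (1.2) p.604, dictionary] -/
theorem eSite_symm_shift (z : Balaban1983to89.Site P j') (μ : Fin P.d) :
    (eSite P r hjj hjr).symm (z.shift μ) = ((eSite P r hjj hjr).symm z).shift μ := by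
  rw [Equiv.symm_apply_eq, eSite_shift, Equiv.apply_symm_apply]

/-- kernel: backward steps under the inverse identification. [cite: Balaban1982Higgs1, (1.2) p.604, dictionary] -/
theorem eSite_symm_unshift (z : Balaban1983to89.Site P j') (μ : Fin P.d) :
    (eSite P r hjj hjr).symm (z.unshift μ) = ((eSite P r hjj hjr).symm z).unshift μ := by
  rw [Equiv.symm_apply_eq, eSite_unshift, Equiv.apply_symm_apply]

end ESite

/-- kernel: `n` forward steps on `T_ε` correspond — [B1] (2.1)'s `u + nεe_μ` is r18's run site `runSite`.
[cite: Balaban1982Higgs1, (2.1) p.608, dictionary] -/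
theorem eSite_shiftN (hr : 0 + r ≤ P.m + P.K) (u : HiggsLattice.Site (higgsOf P r) 0) (μ : Fin P.d) (n : ℕ) :
    eSite P r rfl hr (shiftN u μ n) = runSite (eSite P r rfl hr u) μ n := by
  funext ν
  by_cases h : ν = μ
  · subst h
    simp only [eSite_apply, shiftN, runSite, Function.update_self, map_add, map_natCast]
  · have hx : Function.update u μ (u μ + n) ν = u ν := Function.update_of_ne h _ _
    simp only [eSite_apply, shiftN, runSite, hx, Function.update_of_ne h]

/-- kernel: the Higgs block-map label at every level `i < K_H` (p15's `val_blockOf`, restated for `higgsOf`).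
[cite: Balaban1982Higgs1, (1.17) p.606, dictionary] -/
theorem val_hblockOf {i : ℕ} (hi : i + 1 + r ≤ P.m + P.K) (x : HiggsLattice.Site (higgsOf P r) i) (μ : Fin P.d) :
    ((HiggsLattice.blockOf x) μ).val = (x μ).val / P.L :=
  B2Restr216Lattice.val_blockOf (P := higgsOf P r) (by rw [higgsOf_K]; omega) x μ

/-- kernel: **blocks correspond** (`⌊n/L⌋` coordinatewise in both vocabularies). [cite: Balaban1982Higgs1, (1.17) p.606, dictionary] -/
theorem eSite_blockOf {j j' : ℕ} (hjj : j = j') (hjr : j + 1 + r ≤ P.m + P.K) (x : HiggsLattice.Site (higgsOf P r) j) :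
    eSite P r (congrArg (· + 1) hjj) hjr (HiggsLattice.blockOf x)
      = blockOf (eSite P r hjj (by omega) x) := by
  subst hjj
  refine site_eq_of_val_eq fun μ => ?_
  rw [val_eSite, val_hblockOf hjr, Site.val_blockOf (by omega), val_eSite]

/-- kernel: the `Setup` label of p11's block point `x_i = blkIter i x` is `⌊x/L^i⌋`. [cite: BalabanImbrieJaffe1985, (5.1.2)–(5.1.3) p.313, dictionary] -/
theorem val_blkIter {j : ℕ} : ∀ {i : ℕ}, j + i ≤ P.m + P.K → ∀ (x : Balaban1983to89.Site P j) (μ : Fin P.d),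
    ((blkIter i x) μ).val = (x μ).val / P.L ^ i
  | 0, _, x, μ => by rw [blkIter_zero, pow_zero, Nat.div_one]
  | i + 1, h, x, μ => by
    rw [blkIter_succ, Site.val_blockOf (by omega), val_blkIter (by omega), pow_succ, Nat.div_div_eq_div_mul]

/-- kernel: **the block points `x_i` correspond** ([B1] (2.2) `x ∈ B^j(x_j)` = [BIJ85] (5.1.2)). [cite: Balaban1982Higgs1, (2.2) p.608, dictionary] -/
theorem eSite_blockIter (hr : 0 + r ≤ P.m + P.K) {i : ℕ} (hir : i + r ≤ P.m + P.K) (x : HiggsLattice.Site (higgsOf P r) 0) :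
    eSite P r (Nat.zero_add i).symm hir (blockIter i x) = blkIter i (eSite P r rfl hr x) := by
  refine site_eq_of_val_eq fun μ => ?_
  rw [val_eSite, val_blkIter (by omega), val_eSite,
    B2Ineq329ZeroAveraging.val_blockIter (P := higgsOf P r) (by rw [higgsOf_K]; omega)]

/-- kernel: the label of p11's iterated corner `cornerIter i y` is `L^i·y`. [cite: BalabanImbrieJaffe1985, (2.4) p.302, dictionary] -/
theorem val_cornerIter {j : ℕ} : ∀ {i : ℕ}, j + i ≤ P.m + P.K → ∀ (y : Balaban1983to89.Site P (j + i)) (μ : Fin P.d),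
    ((cornerIter i y) μ).val = (y μ).val * P.L ^ i
  | 0, _, y, μ => by rw [cornerIter_zero, pow_zero, mul_one]
  | i + 1, h, y, μ => by
    rw [cornerIter_succ, val_cornerIter (by omega), val_corner (by omega), pow_succ', mul_assoc]

/-- kernel: **the embedded coarse point corresponds to the iterated corner**: [B1] (1.20)'s `T^{(i)} ⊂ T_ε` (`toFinest`, label
`L^i·y`) is p11's `cornerIter i`. [cite: Balaban1982Higgs1, (1.20) p.607, dictionary] -/
theorem eSite_toFinest (hr : 0 + r ≤ P.m + P.K) {i : ℕ} (hir : i + r ≤ P.m + P.K) (y : HiggsLattice.Site (higgsOf P r) i) :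
    eSite P r rfl hr (toFinest y) = cornerIter i (eSite P r (Nat.zero_add i).symm hir y) := by
  refine site_eq_of_val_eq fun μ => ?_
  rw [val_eSite, val_cornerIter (by omega), val_eSite,
    B2Ineq329PrismHolonomy.val_toFinest (P := higgsOf P r) (by rw [higgsOf_K]; omega)]

/-- kernel: sums over [B1]'s `B^i(y)` are sums over p11's `blockK i (e y)`. [cite: Balaban1982Higgs1, (2.11) p.609, dictionary] -/
theorem sum_blockK_eq {M : Type*} [AddCommMonoid M] (hr : 0 + r ≤ P.m + P.K) {i : ℕ} (hir : i + r ≤ P.m + P.K)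
    (y : HiggsLattice.Site (higgsOf P r) i) (F : HiggsLattice.Site (higgsOf P r) 0 → M) :
    ∑ x ∈ HiggsAveraging.blockK i y, F x
      = ∑ z ∈ BIJ85BlockAveragesTorusK.blockK i (eSite P r (Nat.zero_add i).symm hir y), F ((eSite P r rfl hr).symm z) := by
  refine Finset.sum_equiv (eSite P r rfl hr) (fun x => ?_) (fun x _ => by rw [Equiv.symm_apply_apply])
  rw [HiggsAveraging.mem_blockK, BIJ85BlockAveragesTorusK.mem_blockK, ← eSite_blockIter hr hir,
    (eSite P r _ hir).apply_eq_iff_eq]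

end HiggsOf

/-! ## §3 The `U(1)` field `u = e^{ieεA}` and the holonomy dictionary `u(Γ^{(k)}_{y,x}) = e^{ieεA(Γ^{(k)}_{y,x})}` -/

section Runs

variable {P : Params} {j : ℕ}

/-- kernel: runs compose, `(x + se_μ) + te_μ = x + (s+t)e_μ`. [cite: BalabanImbrieJaffe1985, (2.10) p.303, dictionary] -/
theorem runSite_add (x : Balaban1983to89.Site P j) (μ : Fin P.d) (s t : ℕ) : runSite (runSite x μ s) μ t = runSite x μ (s + t) := by
  funext κ
  by_cases h : κ = μ
  · subst h
    simp only [runSite, Function.update_self]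
    push_cast; ring
  · simp only [runSite, Function.update_of_ne h]

/-- kernel: the bonds of a run from a run site. [cite: BalabanImbrieJaffe1985, (2.10) p.303, dictionary] -/
theorem runBond_runSite (x : Balaban1983to89.Site P j) (μ : Fin P.d) (s t : ℕ) : runBond (runSite x μ s) μ t = runBond x μ (s + t) := by
  simp only [runBond, runSite_add]

/-- kernel: **the corner of a translated block is the translated corner**: `corner(y + te_μ) = corner(y) + tL·e_μ` (r18's `corner_shift`
iterated; standing range). [cite: BalabanImbrieJaffe1985, (2.4) p.302, dictionary] -/
theorem corner_runSite (hj : j + 1 ≤ P.m + P.K) (y : Balaban1983to89.Site P (j + 1)) (μ : Fin P.d) :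
    ∀ t : ℕ, BIJ85BlockAveragesTorus.corner (runSite y μ t) = runSite (BIJ85BlockAveragesTorus.corner y) μ (t * P.L)
  | 0 => by rw [runSite_zero, zero_mul, runSite_zero]
  | t + 1 => by
    rw [← runSite_shift, corner_shift hj, corner_runSite hj y μ t, runSite_add, Nat.succ_mul]

/-- kernel: **the iterated corner of a translated site**: `cornerIter i (w + te_μ) = cornerIter i w + tL^i·e_μ`.
[cite: BalabanImbrieJaffe1985, (2.4) p.302, dictionary] -/
theorem cornerIter_runSite : ∀ {i : ℕ}, j + i ≤ P.m + P.K → ∀ (w : Balaban1983to89.Site P (j + i)) (μ : Fin P.d) (t : ℕ),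
    cornerIter i (runSite w μ t) = runSite (cornerIter i w) μ (t * P.L ^ i)
  | 0, _, w, μ, t => by rw [cornerIter_zero, cornerIter_zero, pow_zero, mul_one]
  | i + 1, h, w, μ, t => by
    rw [cornerIter_succ, corner_runSite (by omega) w μ t, cornerIter_runSite (by omega), cornerIter_succ, pow_succ]
    congr 1
    ring

/-- kernel: a double product over a rectangle is a product over the range of the affine index `t·b + s`. [folklore] -/
private theorem prod_range_mul_eq (f : ℕ → ℂ) (a b : ℕ) :
    ∏ t ∈ range a, ∏ s ∈ range b, f (t * b + s) = ∏ q ∈ range (a * b), f q := by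
  induction a with
  | zero => rw [prod_range_zero, zero_mul, prod_range_zero]
  | succ a ih => rw [prod_range_succ, ih, Nat.succ_mul, prod_range_add]

/-- kernel: a double sum over a rectangle is a sum over the range of the affine index `t·b + s`. [folklore] -/
private theorem sum_range_mul_eq (f : ℕ → ℝ) (a b : ℕ) :
    ∑ t ∈ range a, ∑ s ∈ range b, f (t * b + s) = ∑ q ∈ range (a * b), f q := by
  induction a with
  | zero => rw [sum_range_zero, zero_mul, sum_range_zero]
  | succ a ih => rw [sum_range_succ, ih, Nat.succ_mul, sum_range_add]

/-- **THE ITERATED BLOCK FIELD IS THE ORDERED PRODUCT ALONG THE STRAIGHT FINE RUN**: p11's `u^{(i)} = lineIter U i` on the bond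
`⟨w, w + e_μ⟩` of `T^{(j+i)}` is `Π_{s<L^i} u(⟨c + se_μ, c + (s+1)e_μ⟩)` with `c = cornerIter i w` its corner in `T^{(j)}` ((5.1.3) *"the contour
Γ_{x_k,x} runs from x to x₁ in B(x₁), …"*, each coarse bond a run of fine bonds, (2.5) `u(Γ) = Π u_b`). [cite: BalabanImbrieJaffe1985, (5.1.2)–(5.1.3) p.313] -/
theorem toC_lineIter : ∀ {i : ℕ}, j + i ≤ P.m + P.K → ∀ (U : GaugeField P j U1) (w : Balaban1983to89.Site P (j + i)) (μ : Fin P.d),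
    toC (lineIter U i ⟨w, μ⟩) = ∏ s ∈ range (P.L ^ i), toC (U (runBond (cornerIter i w) μ s))
  | 0, _, U, w, μ => by
    rw [lineIter_zero, pow_zero, prod_range_one, cornerIter_zero]
    simp only [runBond, runSite_zero]
  | i + 1, h, U, w, μ => by
    rw [lineIter_succ, toC_lineU, pow_succ', ← prod_range_mul_eq]
    unfold runC
    refine prod_congr rfl fun t _ => ?_
    rw [show runBond (BIJ85BlockAveragesTorus.corner w) μ t = ⟨runSite (BIJ85BlockAveragesTorus.corner w) μ t, μ⟩ from rfl,
      toC_lineIter (i := i) (by omega) U _ μ, cornerIter_runSite (by omega), ← cornerIter_succ]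
    exact prod_congr rfl fun s _ => by rw [runBond_runSite]

/-- kernel: the leg sites of `Γ_{yx}` are a run from the leg's first site. [cite: BalabanImbrieJaffe1985, (2.4) p.302, dictionary] -/
theorem legSite_eq_runSite (z : Balaban1983to89.Site P j) (μ : Fin P.d) (t : ℕ) : legSite z μ t = runSite (legSite z μ 0) μ t := by
  funext κ
  by_cases h : κ = μ
  · subst h
    simp only [legSite, runSite, lt_irrefl, if_false, if_true, Function.update_self, Nat.cast_zero, add_zero]
  · simp only [legSite, runSite, Function.update_of_ne h, if_neg h]

/-- kernel: the leg bonds as run bonds. [cite: BalabanImbrieJaffe1985, (2.4) p.302, dictionary] -/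
theorem legBond_eq_runBond (z : Balaban1983to89.Site P j) (μ : Fin P.d) (t : ℕ) : legBond z μ t = runBond (legSite z μ 0) μ t := by
  simp only [legBond, runBond, legSite_eq_runSite z μ t]

/-- **ONE SEGMENT `Γ_{x_{i+1},x_i}` OF THE COMPOSITE CONTOUR AS A PRODUCT OF FINE BOND VARIABLES**: p11/r18's `u^{(i)}(Γ_{x_{i+1}x_i}) =
holC (lineIter U i) x_i` equals `Π_μ Π_{q < n_μL^i} u(⟨c_μ + qe_μ, c_μ + (q+1)e_μ⟩)`, `n_μ` the offsets of `x_i` in its block and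
`c_μ = cornerIter i (legSite x_i μ 0)` the fine corner of the `μ`-th leg ((2.4)–(2.5) with (5.1.3); standing range).
[cite: BalabanImbrieJaffe1985, (5.1.2)–(5.1.3) p.313] -/
theorem holC_lineIter {i : ℕ} (h : j + i ≤ P.m + P.K) (U : GaugeField P j U1) (z : Balaban1983to89.Site P (j + i)) :
    holC (lineIter U i) z
      = ∏ μ : Fin P.d, ∏ q ∈ range (BIJ88RenormTransf311.inBlock z μ * P.L ^ i),
          toC (U (runBond (cornerIter i (legSite z μ 0)) μ q)) := by
  unfold holC legProd
  refine prod_congr rfl fun μ _ => ?_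
  rw [← prod_range_mul_eq]
  refine prod_congr rfl fun t _ => ?_
  rw [legBond_eq_runBond, show runBond (legSite z μ 0) μ t = ⟨runSite (legSite z μ 0) μ t, μ⟩ from rfl, toC_lineIter h U _ μ,
    cornerIter_runSite h]
  exact prod_congr rfl fun s _ => by rw [runBond_runSite]

/-- kernel: **the composite transport as a product over the levels**: `u(Γ^{(k)}_{x_k,x}) = Π_{i<k} u^{(i)}(Γ_{x_{i+1}x_i})`.
[cite: BalabanImbrieJaffe1985, (5.1.2)–(5.1.3) p.313] -/
theorem holCK_eq_prod (U : GaugeField P j U1) (k : ℕ) (x : Balaban1983to89.Site P j) :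
    holCK U k x = ∏ i ∈ range k, holC (lineIter U i) (blkIter i x) := by
  induction k with
  | zero => rw [holCK_zero, prod_range_zero]
  | succ k ih => rw [holCK_succ, ih, prod_range_succ, mul_comm]

/-- **THE COMPOSITE TRANSPORT `u(Γ^{(k)}_{x_k,x})` AS A PRODUCT OF FINE BOND VARIABLES** along the legs of every level
(`i < k`; standing range `j + k ≦ m + K`). [cite: BalabanImbrieJaffe1985, (5.1.2)–(5.1.3) p.313] -/
theorem holCK_eq_prod_bonds {k : ℕ} (hk : j + k ≤ P.m + P.K) (U : GaugeField P j U1) (x : Balaban1983to89.Site P j) :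
    holCK U k x = ∏ i ∈ range k, ∏ μ : Fin P.d, ∏ q ∈ range (BIJ88RenormTransf311.inBlock (blkIter i x) μ * P.L ^ i),
      toC (U (runBond (cornerIter i (legSite (blkIter i x) μ 0)) μ q)) := by
  rw [holCK_eq_prod]
  exact prod_congr rfl fun i hi => holC_lineIter (by have := mem_range.1 hi; omega) U _

end Runs

section ExpGauge

variable (P : Params)

/-- **THE `U(1)` FIELD «OF THE FORM `exp[ie_kηA]`»** ([BIJ85] p.326, here on the finest `Setup` torus `T^{(0)}`, spacing `ε = L^{−K}`):
`u_b = e^{ieεA_b}` for a real bond function `A` — the link variables `U(A_b) = e^{qεeA_b}` of [B1] (1.7)/[B4] (1.2) read in `U(1) ≅ SO(2)`.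
[cite: BalabanImbrieJaffe1985, p.326 «a configuration of the form exp[ie_kηA]»] -/
def expGauge (e : ℝ) (A : PBond P 0 → ℝ) : GaugeField P 0 U1 := fun b => expU1 (P.eps * e * A b)

variable {P}

/-- kernel: `u_b = e^{ieεA_b}` read in `ℂ`. [cite: BalabanImbrieJaffe1985, p.326 «a configuration of the form exp[ie_kηA]»] -/
theorem toC_expGauge (e : ℝ) (A : PBond P 0 → ℝ) (b : PBond P 0) :
    toC (expGauge P e A b) = Complex.exp ((P.eps * e * A b : ℝ) * Complex.I) := toC_expU1 _

variable (P) (r : ℕ)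

/-- **THE VECTOR FIELD READ ON THE HIGGS TORUS**: `A_H(⟨x, μ⟩) = A(⟨e(x), μ⟩)` — [B1]'s vector field on `T*_ε` ((1.4) p.604
«A_{⟨x,x+εe_μ⟩} = A_μ(x)») corresponding to the `Setup` bond function `A`. [cite: Balaban1982Higgs1, (1.4) p.604, dictionary] -/
def vecH (hr : 0 + r ≤ P.m + P.K) (A : PBond P 0 → ℝ) : HiggsLattice.VecField (higgsOf P r) 0 :=
  fun b => A ⟨eSite P r rfl hr b.src, b.dir⟩

variable {P r}

/-- kernel: unfolding. [cite: Balaban1982Higgs1, (1.4) p.604, dictionary] -/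
theorem vecH_apply (hr : 0 + r ≤ P.m + P.K) (A : PBond P 0 → ℝ) (x : HiggsLattice.Site (higgsOf P r) 0) (μ : Fin P.d) :
    vecH P r hr A ⟨x, μ⟩ = A ⟨eSite P r rfl hr x, μ⟩ := rfl

/-- kernel: the fine mesh of the Higgs torus is `ε`. [cite: Balaban1982Higgs1, (1.19) p.607, dictionary] -/
theorem higgsOf_mesh_zero : (higgsOf P r).mesh 0 = P.eps := by rw [higgsOf_mesh, Params.spacing_zero]

/-- kernel: `⌊v/L^i⌋L^i − ⌊v/L^{i+1}⌋L^{i+1} = (⌊v/L^i⌋ mod L)·L^i` (the length of the level-`i` leg in fine units). [folklore] -/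
private theorem steps_arith (v L i : ℕ) : v / L ^ i * L ^ i - v / L ^ (i + 1) * L ^ (i + 1) = (v / L ^ i % L) * L ^ i := by
  set q := v / L ^ i with hq
  rw [pow_succ, ← Nat.div_div_eq_div_mul, ← hq, show q / L * (L ^ i * L) = (q / L * L) * L ^ i by ring, ← Nat.sub_mul]
  congr 1
  refine Nat.sub_eq_of_eq_add ?_
  rw [mul_comm]
  exact (Nat.mod_add_div q L).symm

/-- kernel: **THE NUMBER OF STEPS OF THE LEVEL-`i` PIECE OF `Γ^{(k)}_{y,x}` IN DIRECTION `μ`** (p15's `val_steps`) is the offset of the block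
point `x_i` in its block times `L^i`. [cite: Balaban1982Higgs1, (2.2) p.608, dictionary] -/
theorem val_steps_eq_inBlock (hr : 0 + r ≤ P.m + P.K) {i : ℕ} (hi : i + 1 + r ≤ P.m + P.K) (x : HiggsLattice.Site (higgsOf P r) 0)
    (μ : Fin P.d) :
    ((toFinest (blockIter i x)) μ - (toFinest (blockIter (i + 1) x)) μ).val
      = BIJ88RenormTransf311.inBlock (blkIter i (eSite P r rfl hr x)) μ * P.L ^ i := by
  rw [B2Ineq329PrismHolonomy.val_steps (P := higgsOf P r) (by rw [higgsOf_K]; omega), BIJ88RenormTransf311.inBlock,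
    val_blkIter (by omega), val_eSite]
  exact steps_arith _ _ _

/-- kernel: **THE CORNER OF THE LEVEL-`i` LEG IN DIRECTION `μ`**: [B1]'s `corner (toFinest x_{i+1}) (toFinest x_i) μ` ((2.1): coordinates
`≦ μ` of the coarse corner, `> μ` of `x_i`) is, on the `Setup` torus, the fine corner `cornerIter i (legSite x_i μ 0)` of p11/r18's leg —
THE TWO STAIRCASE CONVENTIONS AGREE (corner-based, highest axis first). [cite: Balaban1982Higgs1, (2.1) p.608, dictionary] -/
theorem eSite_corner_leg (hr : 0 + r ≤ P.m + P.K) {i : ℕ} (hi : i + 1 + r ≤ P.m + P.K) (x : HiggsLattice.Site (higgsOf P r) 0)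
    (μ : Fin P.d) :
    eSite P r rfl hr (HiggsAveraging.corner (toFinest (blockIter (i + 1) x)) (toFinest (blockIter i x)) μ)
      = cornerIter i (legSite (blkIter i (eSite P r rfl hr x)) μ 0) := by
  have hKi : i + 1 ≤ (higgsOf P r).K := by rw [higgsOf_K]; omega
  refine site_eq_of_val_eq fun κ => ?_
  rw [val_eSite, val_cornerIter (by omega)]
  simp only [HiggsAveraging.corner, legSite]
  by_cases h1 : κ < μ
  · rw [if_pos h1.le, if_pos h1, B2Ineq329PrismHolonomy.val_toFinest (P := higgsOf P r) hKi,
      B2Ineq329ZeroAveraging.val_blockIter (P := higgsOf P r) hKi, val_corner (by omega),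
      Site.val_blockOf (by omega), val_blkIter (by omega), val_eSite, Nat.div_div_eq_div_mul, higgsOf_L, ← pow_succ, mul_assoc,
      mul_comm P.L (P.L ^ i), ← pow_succ]
  · by_cases h2 : κ = μ
    · subst h2
      rw [if_pos le_rfl, if_neg h1, if_pos rfl, B2Ineq329PrismHolonomy.val_toFinest (P := higgsOf P r) hKi,
        B2Ineq329ZeroAveraging.val_blockIter (P := higgsOf P r) hKi, Nat.cast_zero, add_zero, val_corner (by omega),
        Site.val_blockOf (by omega), val_blkIter (by omega), val_eSite, Nat.div_div_eq_div_mul, higgsOf_L, ← pow_succ, mul_assoc,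
        mul_comm P.L (P.L ^ i), ← pow_succ]
    · have h3 : ¬ κ ≤ μ := fun h => h2 (le_antisymm h (not_lt.1 h1))
      rw [if_neg h3, if_neg h1, if_neg h2, B2Ineq329PrismHolonomy.val_toFinest (P := higgsOf P r) (by omega),
        B2Ineq329ZeroAveraging.val_blockIter (P := higgsOf P r) (by omega), val_blkIter (by omega), val_eSite, higgsOf_L]

/-- **[B1]'s `A(Γ^{(k)}_{y,x})` IS THE SUM OF `A` OVER THE FINE BONDS OF p11's COMPOSITE CONTOUR** (same bonds, same order of legs):
`multiContourSum A_H k x = Σ_{i<k} Σ_μ Σ_{q<n_{i,μ}L^i} A(⟨c_{i,μ} + qe_μ, μ⟩)`. [cite: Balaban1982Higgs1, (2.2)–(2.3) p.608, dictionary] -/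
theorem multiContourSum_vecH (hr : 0 + r ≤ P.m + P.K) {k : ℕ} (hkr : k + r ≤ P.m + P.K) (A : PBond P 0 → ℝ)
    (x : HiggsLattice.Site (higgsOf P r) 0) :
    multiContourSum (vecH P r hr A) k x
      = ∑ i ∈ range k, ∑ μ : Fin P.d, ∑ q ∈ range (BIJ88RenormTransf311.inBlock (blkIter i (eSite P r rfl hr x)) μ * P.L ^ i),
          A (runBond (cornerIter i (legSite (blkIter i (eSite P r rfl hr x)) μ 0)) μ q) := by
  unfold multiContourSum
  refine sum_congr rfl fun i hi => ?_
  have hi' : i + 1 + r ≤ P.m + P.K := by have := mem_range.1 hi; omega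
  unfold contourSum
  refine sum_congr rfl fun μ _ => ?_
  unfold segSum
  rw [val_steps_eq_inBlock hr hi']
  refine sum_congr rfl fun q _ => ?_
  rw [vecH_apply, eSite_shiftN, eSite_corner_leg hr hi']
  rfl

/-- **THE HOLONOMY DICTIONARY**: for the `U(1)` field `u = e^{ieεA}` on the `Setup` torus, p11's composite transport along (5.1.2)–(5.1.3)
IS the exponential of [B1]'s contour sum (2.2)–(2.3): **`u(Γ^{(k)}_{x_k,x}) = exp(ieε·A_H(Γ^{(k)}_{x_k,x}))`** (`k + r ≦ m + K`).
[cite: BalabanImbrieJaffe1985, p.326 «a configuration of the form exp[ie_kηA]»] -/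
theorem holCK_expGauge (hr : 0 + r ≤ P.m + P.K) {k : ℕ} (hkr : k + r ≤ P.m + P.K) (e : ℝ) (A : PBond P 0 → ℝ)
    (x : HiggsLattice.Site (higgsOf P r) 0) :
    holCK (expGauge P e A) k (eSite P r rfl hr x)
      = Complex.exp ((P.eps * e * multiContourSum (vecH P r hr A) k x : ℝ) * Complex.I) := by
  rw [holCK_eq_prod_bonds (by omega), multiContourSum_vecH hr hkr]
  simp only [toC_expGauge, ← Complex.exp_sum]
  congr 1
  rw [mul_sum, Complex.ofReal_sum, sum_mul]
  refine sum_congr rfl fun i _ => ?_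
  rw [mul_sum, Complex.ofReal_sum, sum_mul]
  refine sum_congr rfl fun μ _ => ?_
  rw [mul_sum, Complex.ofReal_sum, sum_mul]

/-- **THE TRANSPORTS OF [B1] (2.11) ARE MULTIPLICATION BY p11's `u(Γ^{(k)}_{x_k,x})`**: for the rotation charge `(e, J)`,
`U(A_H(Γ^{(k)}_{y,x})) = e^{qεeA(Γ)}` acts on `ℝ² ≅ ℂ` as multiplication by `holCK (expGauge e A) k x`.
[cite: Balaban1982Higgs1, (2.11) p.609, dictionary] -/
theorem U_multiContourSum_toE (hr : 0 + r ≤ P.m + P.K) {k : ℕ} (hkr : k + r ≤ P.m + P.K) (e : ℝ) (A : PBond P 0 → ℝ)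
    (x : HiggsLattice.Site (higgsOf P r) 0) (z : ℂ) :
    (rotCharge e).U ((higgsOf P r).mesh 0) (multiContourSum (vecH P r hr A) k x) (toE z)
      = toE (holCK (expGauge P e A) k (eSite P r rfl hr x) * z) := by
  rw [rotCharge_U_toE, higgsOf_mesh_zero, holCK_expGauge hr hkr]

/-- kernel: the link variable of ONE bond: `U(A_H(b)) = e^{qεeA_b}` acts as multiplication by `u_b = e^{ieεA_b}`.
[cite: Balaban1982Higgs1, (1.7) p.605, dictionary] -/
theorem U_bond_toE (hr : 0 + r ≤ P.m + P.K) (e : ℝ) (A : PBond P 0 → ℝ) (x : HiggsLattice.Site (higgsOf P r) 0) (μ : Fin P.d) (z : ℂ) :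
    (rotCharge e).U ((higgsOf P r).mesh 0) (vecH P r hr A ⟨x, μ⟩) (toE z)
      = toE (toC (expGauge P e A ⟨eSite P r rfl hr x, μ⟩) * z) := by
  rw [rotCharge_U_toE, higgsOf_mesh_zero, toC_expGauge, vecH_apply]

/-- kernel: the ADJOINT link variable acts as multiplication by `\overline{u_b}`. [cite: Balaban1982Higgs1, (1.7) p.605, dictionary] -/
theorem star_U_bond_toE (hr : 0 + r ≤ P.m + P.K) (e : ℝ) (A : PBond P 0 → ℝ) (x : HiggsLattice.Site (higgsOf P r) 0) (μ : Fin P.d)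
    (z : ℂ) :
    star ((rotCharge e).U ((higgsOf P r).mesh 0) (vecH P r hr A ⟨x, μ⟩)) (toE z)
      = toE (conj (toC (expGauge P e A ⟨eSite P r rfl hr x, μ⟩)) * z) := by
  rw [HiggsLattice.ChargeData.star_U, rotCharge_U_toE, higgsOf_mesh_zero, toC_expGauge, vecH_apply, ← Complex.exp_conj]
  congr 3
  rw [map_mul, Complex.conj_ofReal, Complex.conj_I]
  push_cast
  ring

end ExpGauge

/-! ## §4 The operator dictionary: block averages, covariant Laplacian, `−Δ^N_{u,Ω} + a_kP_k(u)` versus (2.11), (2.17), (2.20) -/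

section Operators

variable {P : Params} {r : ℕ}

/-- kernel: `(x − e_μ) + e_μ = x` on the `Setup` torus. [folklore] -/
private theorem shift_unshift' {i : ℕ} (z : Balaban1983to89.Site P i) (μ : Fin P.d) : (z.unshift μ).shift μ = z := by
  funext κ
  by_cases h : κ = μ
  · subst h; simp [Balaban1983to89.Site.shift, Balaban1983to89.Site.unshift]
  · simp [Balaban1983to89.Site.shift, Balaban1983to89.Site.unshift, Function.update_of_ne h]

/-- kernel: `(x + e_μ) − e_μ = x` on the `Setup` torus. [folklore] -/
private theorem unshift_shift' {i : ℕ} (z : Balaban1983to89.Site P i) (μ : Fin P.d) : (z.shift μ).unshift μ = z := by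
  funext κ
  by_cases h : κ = μ
  · subst h; simp [Balaban1983to89.Site.shift, Balaban1983to89.Site.unshift]
  · simp [Balaban1983to89.Site.shift, Balaban1983to89.Site.unshift, Function.update_of_ne h]

/-- kernel: `e^{−it} = \overline{e^{it}}` for real `t`. [folklore] -/
private theorem exp_neg_mul_I (t : ℝ) : Complex.exp (((-t : ℝ) : ℂ) * Complex.I) = conj (Complex.exp ((t : ℂ) * Complex.I)) := by
  rw [← Complex.exp_conj, map_mul, Complex.conj_ofReal, Complex.conj_I]
  push_cast
  ring_nf

/-- kernel: `U(−A) = e^{−qηeA}` acts as multiplication by `\overline{e^{iηeA}}`. [cite: Balaban1982Higgs1, (1.7) p.605, dictionary] -/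
theorem rotCharge_U_neg_toE (e η A : ℝ) (z : ℂ) :
    (rotCharge e).U η (-A) (toE z) = toE (conj (Complex.exp ((η * e * A : ℝ) * Complex.I)) * z) := by
  rw [rotCharge_U_toE, show η * e * -A = -(η * e * A) by ring, exp_neg_mul_I]

variable (P r)

/-- **THE REALIFIED FIELD**: a complex scalar field `φ` on the `Setup` torus `T^{(0)}` read as the `ℝ²`-valued (Higgs)₂,₃ field `x ↦ (Re φ, Im φ)(e(x))`
on the Higgs torus ([B1] (1.5) p.604 «φ : T_ε → R^N», `N = 2`). [cite: Balaban1982Higgs1, (1.5) p.604, dictionary] -/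
def rfield (hr : 0 + r ≤ P.m + P.K) (φ : Balaban1983to89.Site P 0 → ℂ) : HiggsLattice.ScalarField (higgsOf P r) 0 2 :=
  fun x => toE (φ (eSite P r rfl hr x))

/-- **THE REALIFIED LEVEL-`k` FIELD** (block averages live on `T^{(k)}`; `Setup` writes its level as `0 + k`).
[cite: Balaban1982Higgs1, (2.11) p.609, dictionary] -/
def rfieldK {k : ℕ} (hkr : k + r ≤ P.m + P.K) (ψ : Balaban1983to89.Site P (0 + k) → ℂ) : HiggsLattice.ScalarField (higgsOf P r) k 2 :=
  fun y => toE (ψ (eSite P r (Nat.zero_add k).symm hkr y))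

/-- **THE REGION READ ON THE HIGGS TORUS**: `Ω_H = e^{−1}(Ω)`. [cite: Balaban1982Higgs1, (2.17) p.610, dictionary] -/
def regH (hr : 0 + r ≤ P.m + P.K) (Ω : Finset (Balaban1983to89.Site P 0)) : Finset (HiggsLattice.Site (higgsOf P r) 0) :=
  Ω.map (eSite P r rfl hr).symm.toEmbedding

variable {P r}

/-- kernel: unfolding. [cite: Balaban1982Higgs1, (1.5) p.604, dictionary] -/
@[simp] theorem rfield_apply (hr : 0 + r ≤ P.m + P.K) (φ : Balaban1983to89.Site P 0 → ℂ) (x : HiggsLattice.Site (higgsOf P r) 0) :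
    rfield P r hr φ x = toE (φ (eSite P r rfl hr x)) := rfl

/-- kernel: unfolding. [cite: Balaban1982Higgs1, (2.11) p.609, dictionary] -/
@[simp] theorem rfieldK_apply {k : ℕ} (hkr : k + r ≤ P.m + P.K) (ψ : Balaban1983to89.Site P (0 + k) → ℂ)
    (y : HiggsLattice.Site (higgsOf P r) k) : rfieldK P r hkr ψ y = toE (ψ (eSite P r (Nat.zero_add k).symm hkr y)) := rfl

/-- kernel: membership in `Ω_H`. [cite: Balaban1982Higgs1, (2.17) p.610, dictionary] -/
theorem mem_regH (hr : 0 + r ≤ P.m + P.K) (Ω : Finset (Balaban1983to89.Site P 0)) (x : HiggsLattice.Site (higgsOf P r) 0) :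
    x ∈ regH P r hr Ω ↔ eSite P r rfl hr x ∈ Ω := by
  unfold regH
  rw [Finset.mem_map_equiv, Equiv.symm_symm]

/-- kernel: the realified field of a sum / scalar multiple. [cite: Balaban1982Higgs1, (1.5) p.604, dictionary] -/
theorem rfield_add_smul (hr : 0 + r ≤ P.m + P.K) (φ ψ : Balaban1983to89.Site P 0 → ℂ) (t : ℝ) :
    rfield P r hr (φ + (t : ℂ) • ψ) = rfield P r hr φ + t • rfield P r hr ψ := by
  funext x
  simp only [rfield_apply, Pi.add_apply, Pi.smul_apply, smul_eq_mul, map_add]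
  rw [← Complex.real_smul, LinearIsometryEquiv.map_smul]

/-! ### (2.11) `Q_k(A)` versus p11/p31's `Q_k(u)` -/

/-- **[B1] (2.11) `Q_k(A_H)` ON THE REALIFIED FIELD IS p11's `Q_k(u)`**: `(Q_k(A_H)φ_ℝ)(y) = (Q_k(u)φ)(e(y))` read in `ℝ²`, `u = e^{ieεA}`
(same blocks `B^k(y)`, same transports by §3, same weight `L^{−kd}`). [cite: Balaban1982Higgs1, (2.11) p.609, dictionary] -/
theorem avgQkLin_rfield (hr : 0 + r ≤ P.m + P.K) {k : ℕ} (hkr : k + r ≤ P.m + P.K) (e : ℝ) (A : PBond P 0 → ℝ)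
    (φ : Balaban1983to89.Site P 0 → ℂ) :
    HiggsCovariance.avgQkLin (rotCharge e) (vecH P r hr A) k (rfield P r hr φ) = rfieldK P r hkr (qCovK (expGauge P e A) k φ) := by
  funext y
  rw [HiggsCovariance.avgQkLin_apply, HiggsAveraging.avgQk_apply, rfieldK_apply, qCovK_apply]
  simp only [rfield_apply, U_multiContourSum_toE hr hkr]
  rw [← map_sum, sum_blockK_eq hr hkr]
  simp only [Equiv.apply_symm_apply]
  rw [← LinearIsometryEquiv.map_smul, Complex.real_smul]
  push_cast
  rfl

/-- **THE ADJOINT [B1] (2.20) `Q_k^*(A_H)` ON A REALIFIED LEVEL-`k` FIELD**: `(Q_k^*(A_H)ψ_ℝ)(x) = \overline{u(Γ^{(k)}_{x_k,x})}·ψ(x_k)` read in `ℝ²` —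
NO weight `L^{−kd}` (the (1.5)-adjoint), versus p31's matrix adjoint `(Q_k|_Ω)ᴴ` which carries `L^{−kd}` (`conjTranspose_qMatK_mulVec`).
[cite: Balaban1982Higgs1, (2.20) p.610, dictionary] -/
theorem avgQkAdj_rfieldK (hr : 0 + r ≤ P.m + P.K) {k : ℕ} (hkr : k + r ≤ P.m + P.K) (e : ℝ) (A : PBond P 0 → ℝ)
    (ψ : Balaban1983to89.Site P (0 + k) → ℂ) (x : HiggsLattice.Site (higgsOf P r) 0) :
    HiggsCovariance.avgQkAdj (rotCharge e) (vecH P r hr A) k (rfieldK P r hkr ψ) x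
      = toE (conj (holCK (expGauge P e A) k (eSite P r rfl hr x)) * ψ (blkIter k (eSite P r rfl hr x))) := by
  show star ((rotCharge e).U ((higgsOf P r).mesh 0) (multiContourSum (vecH P r hr A) k x)) (rfieldK P r hkr ψ (blockIter k x)) = _
  rw [HiggsLattice.ChargeData.star_U, rfieldK_apply, eSite_blockIter hr hkr, rotCharge_U_neg_toE, higgsOf_mesh_zero,
    ← holCK_expGauge hr hkr]

/-- kernel: **p31's matrix adjoint `(Q_k(u)|_Ω)ᴴ` applied to a level-`k` field**: `((Q_k|_Ω)ᴴψ)(x) = [B^k(x_k) ⊆ Ω]·L^{−kd}·\overline{u(Γ^{(k)}_{x_k,x})}·ψ(x_k)`.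
[cite: BalabanImbrieJaffe1988, (2.27) p.263] -/
theorem conjTranspose_qMatK_mulVec {k : ℕ} (U : GaugeField P 0 U1) (Ω : Finset (Balaban1983to89.Site P 0))
    (ψ : Balaban1983to89.Site P (0 + k) → ℂ) (x : Balaban1983to89.Site P 0) :
    ((qMatK U k Ω)ᴴ *ᵥ ψ) x
      = if BIJ85BlockAveragesTorusK.blockK k (blkIter k x) ⊆ Ω then
          ((P.L : ℂ) ^ (k * P.d))⁻¹ * (conj (holCK U k x) * ψ (blkIter k x)) else 0 := by
  rw [mulVec, dotProduct]
  simp_rw [conjTranspose_apply, qMatK_apply]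
  rw [Finset.sum_eq_single (blkIter k x)]
  · have hmem : x ∈ BIJ85BlockAveragesTorusK.blockK k (blkIter k x) := BIJ85BlockAveragesTorusK.mem_blockK_blkIter k x
    by_cases hΩ : BIJ85BlockAveragesTorusK.blockK k (blkIter k x) ⊆ Ω
    · rw [if_pos ⟨hΩ, hmem⟩, if_pos hΩ, Complex.star_def, map_mul, map_inv₀, map_pow, Complex.conj_natCast]
      ring
    · rw [if_neg (fun h => hΩ h.1), if_neg hΩ, star_zero, zero_mul]
  · intro y _ hy
    have hx : x ∉ BIJ85BlockAveragesTorusK.blockK k y := fun h => hy ((BIJ85BlockAveragesTorusK.mem_blockK.1 h).symm)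
    simp [hx]
  · intro h; exact absurd (mem_univ _) h

end Operators

/-! ### (2.17) `−Δ^{ε,N}_{A,Ω}` versus p31's `(χ_ΩD_u)ᴴ(χ_ΩD_u)` -/

section Laplacian

variable {P : Params} {r : ℕ}

/-- kernel: a sum over bonds is a sum over (source, direction). [folklore] -/
private theorem sum_bond_eq' {i : ℕ} {α : Type*} [AddCommMonoid α] (F : PBond P i → α) :
    ∑ b : PBond P i, F b = ∑ x : Balaban1983to89.Site P i, ∑ μ : Fin P.d, F ⟨x, μ⟩ := by
  rw [← Fintype.sum_prod_type']
  exact (Fintype.sum_equiv (⟨fun p => ⟨p.1, p.2⟩, fun b => (b.src, b.dir), fun _ => rfl, fun _ => rfl⟩ :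
    Balaban1983to89.Site P i × Fin P.d ≃ PBond P i) (fun p => F ⟨p.1, p.2⟩) F fun _ => rfl).symm

/-- kernel: the bonds with source `z` indexed by their direction. [folklore] -/
private theorem sum_bond_ite_src' {i : ℕ} (z : Balaban1983to89.Site P i) (p : PBond P i → Prop) [DecidablePred p] (G : PBond P i → ℂ) :
    ∑ b : PBond P i, (if p b ∧ z = b.src then G b else 0) = ∑ μ : Fin P.d, (if p ⟨z, μ⟩ then G ⟨z, μ⟩ else 0) := by
  rw [sum_bond_eq']
  have key : ∀ x : Balaban1983to89.Site P i, ∑ μ : Fin P.d, (if p ⟨x, μ⟩ ∧ z = (⟨x, μ⟩ : PBond P i).src then G ⟨x, μ⟩ else 0)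
      = if z = x then ∑ μ : Fin P.d, (if p ⟨x, μ⟩ then G ⟨x, μ⟩ else 0) else 0 := by
    intro x
    by_cases h : z = x
    · subst h; simp only [and_true, if_true]
    · rw [if_neg h]; exact sum_eq_zero fun μ _ => if_neg fun hh => h hh.2
  simp_rw [key]
  rw [sum_ite_eq univ z, if_pos (mem_univ _)]

/-- kernel: the bonds with target `z` indexed by their direction (`b = ⟨z − e_μ, μ⟩`). [folklore] -/
private theorem sum_bond_ite_tgt' {i : ℕ} (z : Balaban1983to89.Site P i) (p : PBond P i → Prop) [DecidablePred p] (G : PBond P i → ℂ) :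
    ∑ b : PBond P i, (if p b ∧ z = b.tgt then G b else 0) = ∑ μ : Fin P.d, (if p ⟨z.unshift μ, μ⟩ then G ⟨z.unshift μ, μ⟩ else 0) := by
  rw [sum_bond_eq']
  have key : ∀ x : Balaban1983to89.Site P i, ∑ μ : Fin P.d, (if p ⟨x, μ⟩ ∧ z = (⟨x, μ⟩ : PBond P i).tgt then G ⟨x, μ⟩ else 0)
      = ∑ μ : Fin P.d, (if x = z.unshift μ then (if p ⟨z.unshift μ, μ⟩ then G ⟨z.unshift μ, μ⟩ else 0) else 0) := by
    intro x
    refine sum_congr rfl fun μ _ => ?_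
    have htgt : (⟨x, μ⟩ : PBond P i).tgt = x.shift μ := rfl
    by_cases h : x = z.unshift μ
    · subst h; rw [htgt, shift_unshift', if_pos rfl]; simp only [and_true]
    · rw [if_neg h]
      refine if_neg fun hh => h ?_
      rw [hh.2, htgt, unshift_shift']
  simp_rw [key]
  rw [sum_comm]
  exact sum_congr rfl fun μ _ => by rw [sum_ite_eq' univ (z.unshift μ), if_pos (mem_univ _)]

/-- **THE NEUMANN COVARIANT LAPLACIAN OF A REGION, ENTRYWISE** (p27's whole-torus `gram_dN_mulVec_apply` with the Neumann cut-off
`χ_Ω`): `((χ_ΩD_u)ᴴ(χ_ΩD_u)φ)(z) = c²Σ_μ([⟨z,z+e_μ⟩ ⊂ Ω](φ(z) − u_{⟨z,μ⟩}φ(z+e_μ)) + [⟨z−e_μ,z⟩ ⊂ Ω](φ(z) − ū_{⟨z−e_μ,μ⟩}φ(z−e_μ)))` (`|u_b| = 1`)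
— the shape of [B1] (2.17)'s forward/backward Neumann terms. [cite: BalabanImbrieJaffe1988, (5.6.10) p.287] -/
theorem gram_dN_mulVec_apply_region (c : ℝ) (U : GaugeField P 0 U1) (Ω : Finset (Balaban1983to89.Site P 0))
    (φ : Balaban1983to89.Site P 0 → ℂ) (z : Balaban1983to89.Site P 0) :
    (((dN c U Ω)ᴴ * dN c U Ω) *ᵥ φ) z
      = (c : ℂ) ^ 2 * ∑ μ : Fin P.d,
          ((if (⟨z, μ⟩ : PBond P 0) ∈ BIJ88Sect3Statements.starB Ω then φ z - cfg U ⟨z, μ⟩ * φ (z.shift μ) else 0)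
          + (if (⟨z.unshift μ, μ⟩ : PBond P 0) ∈ BIJ88Sect3Statements.starB Ω then
              φ z - conj (cfg U ⟨z.unshift μ, μ⟩) * φ (z.unshift μ) else 0)) := by
  classical
  rw [← mulVec_mulVec, mulVec, dotProduct]
  simp_rw [conjTranspose_apply, dN_mulVec, dN_apply]
  have hterm : ∀ b : PBond P 0,
      star (if b ∈ BIJ88Sect3Statements.starB Ω then BIJ88Vj5610Operator.dMat c (cfg U) b z else 0)
          * (if b ∈ BIJ88Sect3Statements.starB Ω then covD c (cfg U) φ b else 0)
        = (if b ∈ BIJ88Sect3Statements.starB Ω ∧ z = b.tgt then (c : ℂ) ^ 2 * (φ z - conj (cfg U b) * φ b.src) else 0)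
          + (if b ∈ BIJ88Sect3Statements.starB Ω ∧ z = b.src then (c : ℂ) ^ 2 * (φ z - cfg U b * φ b.tgt) else 0) := by
    intro b
    by_cases hb : b ∈ BIJ88Sect3Statements.starB Ω
    · simp only [hb, if_true, true_and]
      have hu : conj (cfg U b) * cfg U b = 1 := BIJ88NeumannPropagator227Torus.conj_mul_toC (U b)
      have hstar : star (BIJ88Vj5610Operator.dMat c (cfg U) b z)
          = (c : ℂ) * (if z = b.tgt then conj (cfg U b) else 0) - (c : ℂ) * (if z = b.src then 1 else 0) := by
        rw [BIJ88Vj5610Operator.dMat, Matrix.of_apply, Complex.star_def, map_sub, map_mul, map_mul, Complex.conj_ofReal]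
        congr 2
        · split_ifs <;> simp
        · split_ifs <;> simp
      rw [hstar]
      unfold covD
      by_cases h1 : z = b.tgt
      · by_cases h2 : z = b.src
        · rw [if_pos h1, if_pos h2, if_pos h1, if_pos h2, ← h1, ← h2]
          linear_combination ((c : ℂ) ^ 2 * φ z) * hu
        · rw [if_pos h1, if_neg h2, if_pos h1, if_neg h2, ← h1]
          linear_combination ((c : ℂ) ^ 2 * φ z) * hu
      · by_cases h2 : z = b.src
        · rw [if_neg h1, if_pos h2, if_neg h1, if_pos h2, ← h2]
          ring
        · rw [if_neg h1, if_neg h2, if_neg h1, if_neg h2]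
          ring
    · simp [hb]
  simp_rw [hterm]
  rw [sum_add_distrib, sum_bond_ite_tgt' z (fun b => b ∈ BIJ88Sect3Statements.starB Ω),
    sum_bond_ite_src' z (fun b => b ∈ BIJ88Sect3Statements.starB Ω), mul_sum, ← sum_add_distrib]
  refine sum_congr rfl fun μ _ => ?_
  have hsrc : (⟨z, μ⟩ : PBond P 0).tgt = z.shift μ := rfl
  simp only [hsrc]
  split_ifs <;> ring

/-- kernel: the bond `⟨e(x), μ⟩` lies in `Ω` iff `x, x + e_μ ∈ Ω_H`. [cite: Balaban1982Higgs1, (2.17) p.610, dictionary] -/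
theorem fwd_mem_iff (hr : 0 + r ≤ P.m + P.K) (Ω : Finset (Balaban1983to89.Site P 0)) (x : HiggsLattice.Site (higgsOf P r) 0) (μ : Fin P.d) :
    (x ∈ regH P r hr Ω ∧ x.shift μ ∈ regH P r hr Ω) ↔ (⟨eSite P r rfl hr x, μ⟩ : PBond P 0) ∈ BIJ88Sect3Statements.starB Ω := by
  rw [BIJ88Sect3Statements.mem_starB, mem_regH, mem_regH, eSite_shift]
  rfl

/-- kernel: the bond `⟨e(x) − e_μ, μ⟩` lies in `Ω` iff `x, x − e_μ ∈ Ω_H`. [cite: Balaban1982Higgs1, (2.17) p.610, dictionary] -/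
theorem bwd_mem_iff (hr : 0 + r ≤ P.m + P.K) (Ω : Finset (Balaban1983to89.Site P 0)) (x : HiggsLattice.Site (higgsOf P r) 0) (μ : Fin P.d) :
    (x ∈ regH P r hr Ω ∧ x.unshift μ ∈ regH P r hr Ω)
      ↔ (⟨(eSite P r rfl hr x).unshift μ, μ⟩ : PBond P 0) ∈ BIJ88Sect3Statements.starB Ω := by
  rw [BIJ88Sect3Statements.mem_starB, mem_regH, mem_regH, eSite_unshift, and_comm]
  show _ ↔ _ ∧ ((eSite P r rfl hr x).unshift μ).shift μ ∈ Ω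
  rw [shift_unshift']

/-- **[B1] (2.17) `−Δ^{ε,N}_{A_H,Ω_H}` ON THE REALIFIED FIELD IS p31's `(χ_ΩD_u)ᴴ(χ_ΩD_u)` AT `c = ε⁻¹`, `u = e^{ieεA}`** (the same Neumann bonds,
the link variable `U(A_b)` acting as `u_b`, its adjoint as `ū_b`). [cite: Balaban1982Higgs1, (2.17) p.610, dictionary] -/
theorem covLaplacianN_rfield (hr : 0 + r ≤ P.m + P.K) (e : ℝ) (A : PBond P 0 → ℝ) (Ω : Finset (Balaban1983to89.Site P 0))
    (φ : Balaban1983to89.Site P 0 → ℂ) (x : HiggsLattice.Site (higgsOf P r) 0) :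
    HiggsCovariance.covLaplacianN (rotCharge e) (regH P r hr Ω) (vecH P r hr A) (rfield P r hr φ) x
      = toE ((((dN P.eps⁻¹ (expGauge P e A) Ω)ᴴ * dN P.eps⁻¹ (expGauge P e A) Ω) *ᵥ φ) (eSite P r rfl hr x)) := by
  classical
  rw [gram_dN_mulVec_apply_region]
  simp only [HiggsCovariance.covLaplacianN, LinearMap.pi_apply, LinearMap.smul_apply, LinearMap.coe_sum, Finset.sum_apply,
    LinearMap.add_apply, HiggsCovarianceCont.fwdTerm_apply, HiggsCovarianceCont.bwdTerm_apply, higgsOf_mesh_zero]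
  rw [show (((P.eps⁻¹ : ℝ) : ℂ)) ^ 2 = (((P.eps⁻¹) ^ 2 : ℝ) : ℂ) by push_cast; ring, ← Complex.real_smul, LinearIsometryEquiv.map_smul,
    map_sum]
  congr 1
  refine sum_congr rfl fun μ _ => ?_
  rw [map_add]
  congr 1
  · by_cases h : x ∈ regH P r hr Ω ∧ x.shift μ ∈ regH P r hr Ω
    · rw [if_pos h, if_pos ((fwd_mem_iff hr Ω x μ).1 h), rfield_apply, rfield_apply, rotCharge_U_toE, vecH_apply, ← toC_expGauge,
        eSite_shift, map_sub]
      rfl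
    · rw [if_neg h, if_neg (fun h' => h ((fwd_mem_iff hr Ω x μ).2 h')), map_zero]
  · by_cases h : x ∈ regH P r hr Ω ∧ x.unshift μ ∈ regH P r hr Ω
    · rw [if_pos h, if_pos ((bwd_mem_iff hr Ω x μ).1 h), rfield_apply, rfield_apply, rotCharge_U_neg_toE, vecH_apply,
        ← toC_expGauge, eSite_unshift, map_sub]
      rfl
    · rw [if_neg h, if_neg (fun h' => h ((bwd_mem_iff hr Ω x μ).2 h')), map_zero]

end Laplacian

/-! ### (2.20) `a_k(L^kε)^{−2}P_k(A)` versus p31's `α_kL^{kd}(Q_k|_Ω)ᴴ(Q_k|_Ω)`, and `−Δ + m² + a_k(L^kε)^{−2}P_k` versus `nOp + m²` -/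

section CovOp

variable {P : Params} {r : ℕ}

/-- kernel: on a `k`-block union, a block that is not inside `Ω` does not meet `Ω`. [cite: BalabanImbrieJaffe1988, (2.27) p.263] -/
theorem blockK_disjoint_of_not_subset {k : ℕ} {Ω : Finset (Balaban1983to89.Site P 0)} (hΩ : BIJ88NeumannNoZeroModesTorus.IsBlockUnion k Ω)
    {y : Balaban1983to89.Site P (0 + k)} (hy : ¬ BIJ85BlockAveragesTorusK.blockK k y ⊆ Ω) {x : Balaban1983to89.Site P 0}
    (hx : x ∈ BIJ85BlockAveragesTorusK.blockK k y) : x ∉ Ω := by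
  intro hxΩ
  have h := hΩ x hxΩ
  rw [BIJ85BlockAveragesTorusK.mem_blockK.1 hx] at h
  exact hy h

/-- kernel: **the block average of a field supported in a block union vanishes on the blocks outside it**.
[cite: BalabanImbrieJaffe1988, (2.27) p.263] -/
theorem qCovK_eq_zero_of_not_subset {k : ℕ} {Ω : Finset (Balaban1983to89.Site P 0)} (hΩ : BIJ88NeumannNoZeroModesTorus.IsBlockUnion k Ω)
    (U : GaugeField P 0 U1) {φ : Balaban1983to89.Site P 0 → ℂ} (hφ : ∀ z, z ∉ Ω → φ z = 0) {y : Balaban1983to89.Site P (0 + k)}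
    (hy : ¬ BIJ85BlockAveragesTorusK.blockK k y ⊆ Ω) : qCovK U k φ y = 0 := by
  rw [qCovK_apply]
  refine mul_eq_zero_of_right _ (sum_eq_zero fun x hx => ?_)
  rw [hφ x (blockK_disjoint_of_not_subset hΩ hy hx), mul_zero]

/-- **[B1] (2.20) `a_k(L^kε)^{−2}P_k(A_H)` ON A REALIFIED FIELD SUPPORTED IN A BLOCK UNION `Ω` IS p31's `α_kL^{kd}·(Q_k(u)|_Ω)ᴴ(Q_k(u)|_Ω)`**
(`α_k = a_k(L^kε)^{−2}` = pv07's `α P a k`; the (1.5)-adjoint `Q_k^*` = `L^{kd}·(Q_k)ᴴ`). [cite: Balaban1982Higgs1, (2.20) p.610, dictionary] -/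
theorem projPk_rfield (hr : 0 + r ≤ P.m + P.K) {k : ℕ} (hkr : k + r ≤ P.m + P.K) (e : ℝ) (A : PBond P 0 → ℝ) (a : ℝ)
    {Ω : Finset (Balaban1983to89.Site P 0)} (hΩ : BIJ88NeumannNoZeroModesTorus.IsBlockUnion k Ω)
    {φ : Balaban1983to89.Site P 0 → ℂ} (hφ : ∀ z, z ∉ Ω → φ z = 0) (x : HiggsLattice.Site (higgsOf P r) 0) :
    (B1.aSeq a ((higgsOf P r).L : ℝ) k * ((higgsOf P r).mesh k)⁻¹ ^ 2) • HiggsCovariance.projPk (rotCharge e) (vecH P r hr A) k (rfield P r hr φ) x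
      = toE ((((B1RG242Torus.α P a k * (P.L : ℝ) ^ (k * P.d) : ℝ) : ℂ)
          • (((qMatK (expGauge P e A) k Ω)ᴴ * qMatK (expGauge P e A) k Ω) *ᵥ φ)) (eSite P r rfl hr x)) := by
  rw [show HiggsCovariance.projPk (rotCharge e) (vecH P r hr A) k (rfield P r hr φ) x
      = HiggsCovariance.avgQkAdj (rotCharge e) (vecH P r hr A) k
          (HiggsCovariance.avgQkLin (rotCharge e) (vecH P r hr A) k (rfield P r hr φ)) x from rfl,
    avgQkLin_rfield hr hkr, avgQkAdj_rfieldK hr hkr, Pi.smul_apply, ← mulVec_mulVec, smul_eq_mul, conjTranspose_qMatK_mulVec,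
    qMatK_mulVec, ← LinearIsometryEquiv.map_smul, Complex.real_smul, higgsOf_mesh, higgsOf_L]
  congr 1
  by_cases hy : BIJ85BlockAveragesTorusK.blockK k (blkIter k (eSite P r rfl hr x)) ⊆ Ω
  · rw [if_pos hy, if_pos hy, B1RG242Torus.α]
    have hL : ((P.L : ℂ) ^ (k * P.d)) ≠ 0 := pow_ne_zero _ (Nat.cast_ne_zero.2 (by have := P.hL.2; omega))
    push_cast
    field_simp
  · rw [if_neg hy, qCovK_eq_zero_of_not_subset hΩ _ hφ hy]
    simp

/-- kernel: `nOp` maps into fields supported in `Ω`. [cite: BalabanImbrieJaffe1988, (2.27) p.263] -/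
theorem nOp_mulVec_eq_zero_of_not_mem {k : ℕ} (a c : ℝ) (U : GaugeField P 0 U1) (Ω : Finset (Balaban1983to89.Site P 0))
    (φ : Balaban1983to89.Site P 0 → ℂ) {z : Balaban1983to89.Site P 0} (hz : z ∉ Ω) : (nOp a c U k Ω *ᵥ φ) z = 0 := by
  rw [← BIJ88NeumannPropagator227Torus.proj_mul_nOp, ← mulVec_mulVec, proj_mulVec, if_neg hz]

/-- **THE OPERATOR DICTIONARY**: for a `k`-block union `Ω ⊂ T^{(0)}` and a field `φ` supported in `Ω`,
[B1] (2.20)'s `(−Δ^{ε,N}_{A_H,Ω_H} + m² + a_k(L^kε)^{−2}P_k(A_H))φ_ℝ` IS, read in `ℝ²`, p31's `(−Δ^N_{u,Ω} + α_kL^{kd}Q_k(u)|_Ωᴴ Q_k(u)|_Ω + m²)φ =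
(nOp (α_kL^{kd}) ε⁻¹ u k Ω + m²)φ` at `u = e^{ieεA}` — [7]'s/[B1]'s covariant operator (1.6)/(2.20) for `N = 2` AND [BIJ88]'s Neumann operator
(2.27)/[BIJ85] (4.6.2) are ONE operator. [cite: BalabanImbrieJaffe1985, p.326 «a configuration of the form exp[ie_kηA]»] -/
theorem covOpK_rfield (hr : 0 + r ≤ P.m + P.K) {k : ℕ} (hkr : k + r ≤ P.m + P.K) (e : ℝ) (A : PBond P 0 → ℝ) (msq a : ℝ)
    {Ω : Finset (Balaban1983to89.Site P 0)} (hΩ : BIJ88NeumannNoZeroModesTorus.IsBlockUnion k Ω)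
    {φ : Balaban1983to89.Site P 0 → ℂ} (hφ : ∀ z, z ∉ Ω → φ z = 0) :
    HiggsCovariance.covOpK (rotCharge e) (regH P r hr Ω) (vecH P r hr A) msq a k (rfield P r hr φ)
      = rfield P r hr (nOp (B1RG242Torus.α P a k * (P.L : ℝ) ^ (k * P.d)) P.eps⁻¹ (expGauge P e A) k Ω *ᵥ φ + (msq : ℂ) • φ) := by
  funext x
  rw [HiggsCovariance.covOpK, LinearMap.add_apply, LinearMap.add_apply, LinearMap.smul_apply, LinearMap.smul_apply,
    LinearMap.id_apply, Pi.add_apply, Pi.add_apply, Pi.smul_apply, Pi.smul_apply, covLaplacianN_rfield hr,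
    projPk_rfield hr hkr e A a hΩ hφ, rfield_apply, rfield_apply, nOp_eq, add_mulVec, smul_mulVec, Pi.add_apply, Pi.add_apply,
    Pi.smul_apply, Pi.smul_apply, map_add, map_add, smul_eq_mul, ← Complex.real_smul, LinearIsometryEquiv.map_smul,
    show ((msq : ℝ) : ℂ) • φ (eSite P r rfl hr x) = (msq : ℝ) • φ (eSite P r rfl hr x) from by rw [smul_eq_mul, Complex.real_smul],
    LinearIsometryEquiv.map_smul]
  abel

end CovOp

/-! ## §5 Propagators: the C2 Neumann propagator `G_k(Ω,u)` (2.27) solves [B1]'s (2.20) at `m² = 0`; the massive uniqueness transfer -/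

section Propagators

variable {P : Params} {r : ℕ}

variable (P r) in
/-- **THE COMPLEX FIELD OF A REALIFIED ONE** (inverse of `rfield`): `φ(z) = toE⁻¹(Φ(e⁻¹z))`. [cite: Balaban1982Higgs1, (1.5) p.604, dictionary] -/
def cfield (hr : 0 + r ≤ P.m + P.K) (Φ : HiggsLattice.ScalarField (higgsOf P r) 0 2) : Balaban1983to89.Site P 0 → ℂ :=
  fun z => toE.symm (Φ ((eSite P r rfl hr).symm z))

/-- kernel: `cfield ∘ rfield = id`. [cite: Balaban1982Higgs1, (1.5) p.604, dictionary] -/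
@[simp] theorem cfield_rfield (hr : 0 + r ≤ P.m + P.K) (φ : Balaban1983to89.Site P 0 → ℂ) : cfield P r hr (rfield P r hr φ) = φ := by
  funext z; simp [cfield, rfield]

/-- kernel: `rfield ∘ cfield = id`. [cite: Balaban1982Higgs1, (1.5) p.604, dictionary] -/
@[simp] theorem rfield_cfield (hr : 0 + r ≤ P.m + P.K) (Φ : HiggsLattice.ScalarField (higgsOf P r) 0 2) : rfield P r hr (cfield P r hr Φ) = Φ := by
  funext x; simp [cfield, rfield]

/-- kernel: realification is injective. [cite: Balaban1982Higgs1, (1.5) p.604, dictionary] -/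
theorem rfield_injective (hr : 0 + r ≤ P.m + P.K) : Function.Injective (rfield P r hr) := fun φ ψ h => by
  rw [← cfield_rfield hr φ, h, cfield_rfield]

/-- kernel: the norm of the realified field at a site is the modulus of the complex field. [cite: Balaban1982Higgs1, (1.5) p.604, dictionary] -/
theorem norm_rfield_apply (hr : 0 + r ≤ P.m + P.K) (φ : Balaban1983to89.Site P 0 → ℂ) (x : HiggsLattice.Site (higgsOf P r) 0) :
    ‖rfield P r hr φ x‖ = ‖φ (eSite P r rfl hr x)‖ := by
  rw [rfield_apply, LinearIsometryEquiv.norm_map]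

/-- kernel: a field supported in `Ω` is fixed by `1_Ω`. [cite: BalabanImbrieJaffe1988, (2.27) p.263] -/
theorem proj_mulVec_eq_self {Ω : Finset (Balaban1983to89.Site P 0)} {f : Balaban1983to89.Site P 0 → ℂ} (hf : ∀ z, z ∉ Ω → f z = 0) :
    proj Ω *ᵥ f = f := by
  funext z
  rw [proj_mulVec]
  by_cases hz : z ∈ Ω
  · rw [if_pos hz]
  · rw [if_neg hz, hf z hz]

/-- kernel: `G_k(Ω,u)f` is supported in `Ω`. [cite: BalabanImbrieJaffe1988, (2.27) p.263] -/
theorem gBox_mulVec_eq_zero_of_not_mem {k : ℕ} {a c : ℝ} {U : GaugeField P 0 U1} {Ω : Finset (Balaban1983to89.Site P 0)}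
    (hN : IsUnit (nPad a c U k Ω)) (f : Balaban1983to89.Site P 0 → ℂ) {z : Balaban1983to89.Site P 0} (hz : z ∉ Ω) :
    (gBox a c U k Ω *ᵥ f) z = 0 := by
  rw [← BIJ88NeumannPropagator227Torus.proj_mul_gBox hN, ← mulVec_mulVec, proj_mulVec, if_neg hz]

/-- **THE C2 NEUMANN PROPAGATOR SOLVES [B1]'s (2.20) AT `m² = 0`**: for a `k`-block union `Ω` (`1 ≦ k`, `k + r ≦ m + K`) and a source `f` supported in
`Ω`, the realified column `ψ = G_k(Ω,u)f` of p31's `gBox (α_kL^{kd}) ε⁻¹ u k Ω` at `u = e^{ieεA}` satisfies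
`(−Δ^{ε,N}_{A_H,Ω_H} + a_k(L^kε)^{−2}P_k(A_H))ψ_ℝ = f_ℝ` — [7]'s `G_k(Ω,A)` (1.6) at `m² = 0` for `N = 2` IS [BIJ88]'s `G_k(Ω,u)`.
[cite: BalabanImbrieJaffe1985, p.326 «The propagators arising from Δ_k(u_k) … also satisfy the regularity and decay estimates of [7]»] -/
theorem covOpK_rfield_gBox (hr : 0 + r ≤ P.m + P.K) {k : ℕ} (hk1 : 1 ≤ k) (hkr : k + r ≤ P.m + P.K) (e : ℝ) (A : PBond P 0 → ℝ)
    {a : ℝ} (ha : 0 < a) {Ω : Finset (Balaban1983to89.Site P 0)} (hΩ : BIJ88NeumannNoZeroModesTorus.IsBlockUnion k Ω)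
    {f : Balaban1983to89.Site P 0 → ℂ} (hf : ∀ z, z ∉ Ω → f z = 0) :
    HiggsCovariance.covOpK (rotCharge e) (regH P r hr Ω) (vecH P r hr A) 0 a k
        (rfield P r hr (gBox (B1RG242Torus.α P a k * (P.L : ℝ) ^ (k * P.d)) P.eps⁻¹ (expGauge P e A) k Ω *ᵥ f))
      = rfield P r hr f := by
  have hα : 0 < B1RG242Torus.α P a k * (P.L : ℝ) ^ (k * P.d) :=
    mul_pos (mul_pos (B1.aSeq_pos ha (B1RG242Torus.one_lt_cast_L P) hk1) (inv_pos.2 (pow_pos (P.spacing_pos k) 2)))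
      (pow_pos P.cast_L_pos _)
  have hN := BIJ88NeumannPropagator227Torus.isUnit_nPad (j := 0) (by omega) (inv_ne_zero P.eps_pos.ne') hα (expGauge P e A) hΩ
  rw [covOpK_rfield hr hkr e A 0 a hΩ (fun z hz => gBox_mulVec_eq_zero_of_not_mem hN f hz), mulVec_mulVec,
    BIJ88NeumannPropagator227Torus.nOp_mul_gBox hN, proj_mulVec_eq_self hf, Complex.ofReal_zero, zero_smul, add_zero]

/-- **UNIQUENESS TRANSFER AT `m² > 0`**: if `ψ` is supported in the `k`-block union `Ω` and solves p31's equation `(nOp (α_kL^{kd}) ε⁻¹ u k Ω + m²)ψ = f`,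
then the realified `ψ` IS [B1]'s propagator column `G^ε_k(Ω_H, A_H)f_ℝ` (2.20) (`propagatorK`, a two-sided inverse for `m² > 0`, `a_k ≧ 0` — typer/p35's
`HiggsCovariancePos.isUnit_covOpK`). [cite: Balaban1982Higgs1, (2.20) p.610, dictionary] -/
theorem propagatorK_rfield_eq (hr : 0 + r ≤ P.m + P.K) {k : ℕ} (hkr : k + r ≤ P.m + P.K) (e : ℝ) (A : PBond P 0 → ℝ) {msq : ℝ}
    (hmsq : 0 < msq) {a : ℝ} (hak : 0 ≤ B1.aSeq a (P.L : ℝ) k) {Ω : Finset (Balaban1983to89.Site P 0)}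
    (hΩ : BIJ88NeumannNoZeroModesTorus.IsBlockUnion k Ω) {ψ f : Balaban1983to89.Site P 0 → ℂ} (hψ : ∀ z, z ∉ Ω → ψ z = 0)
    (heq : nOp (B1RG242Torus.α P a k * (P.L : ℝ) ^ (k * P.d)) P.eps⁻¹ (expGauge P e A) k Ω *ᵥ ψ + (msq : ℂ) • ψ = f) :
    HiggsCovariance.propagatorK (rotCharge e) (regH P r hr Ω) (vecH P r hr A) msq a k (rfield P r hr f) = rfield P r hr ψ := by
  have h := HiggsCovariancePos.propagatorK_covOpK_apply (rotCharge e) (regH P r hr Ω) (vecH P r hr A) hmsq a k hak (rfield P r hr ψ)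
  rw [covOpK_rfield hr hkr e A msq a hΩ hψ, heq] at h
  exact h

end Propagators

end

end Literature.MathematicalPhysics.QuantumFieldTheory.BalabanImbrieJaffe1984to88.BIJ85CovariantHiggsDictionary
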